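import Literature.NumberTheory.ConnesMoscovici2022.UVProlateSpectrumProofs
import Mathlib.Analysis.Distribution.AEEqOfIntegralContDiff
import Mathlib.Analysis.Calculus.BumpFunction.Normed
import Mathlib.Analysis.Calculus.BumpFunction.InnerProduct
import Mathlib.MeasureTheory.Measure.OpenPos
import Mathlib.MeasureTheory.Integral.DivergenceTheorem

/-!
# RH-FREE. Connes–Moscovici 2022, Lemma 1.2: the boundary functional `L(ξ) = lim_{x→a} p ∂ξ` on `dom W_max`

LINE 1 FRAMING: this file is RH-FREE corpus literature (cell rh-crit, C1 Connes–Consani/Moscovici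
corpus, row O2 `UVProlateSpectrum`).  bears_on: W-C/W-P only (the self-adjointness theory of the
prolate wave operator `W_λ = −∂ₓ(λ² − x²)∂ₓ + (2πλx)²`, sequel material with no leaf role in any
route).  WHAT THIS IS NOT: nothing here bears on the truth of RH; no statement about zeta zeros;
no new definition, no new named fact (theorems only; net debt −1: it DISCHARGES the tree's named
fact `Literature.NumberTheory.ConnesMoscovici2022.CM22_lemma_1_2`).

## Source

A. Connes, H. Moscovici, *The UV prolate spectrum matches the zeros of zeta*, PNAS 119 (2022)
[ConnesMoscovici2022], Lemma 1.2 = arXiv:2112.05500v1 Lemma 2.2 (materialised text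
`paper-arxiv-2112.05500`, chunk p0004:L50–L104):

> Let `λ > 0` and `a ∈ {±λ}`. (i) any `ξ ∈ Dom W_max` has a boundary value `lim_{x→a} p(x)∂ₓξ(x)`;
> (ii) `L(ξ) := lim p ∂ξ` is a nonzero linear form on `Dom W_max`, continuous in the graph norm
> and vanishing on `Dom W_min`.

## Architecture (mirrors the printed proof; deviations flagged)

* §1 `TestFunctions` — smooth bumps in an open interval, primitives of mean-zero test functions,
  the du Bois-Reymond lemmas (`∫ v Θ′ = 0 ∀Θ ⇒ v` a.e. constant; `∫ v Θ′ = −∫ w Θ ⇒ v = ∫w + k`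
  a.e.), all on a bounded open interval `(α, β)` [folklore; Mathlib's
  `ae_eq_zero_of_integral_contDiff_smul_eq_zero` is the engine].
* §2 `WeakIdentities` — "Let `η = W_max ξ`, one has by definition `⟨η|φ⟩ = ⟨ξ|W_min φ⟩`", i.e.
  `∫ (Wθ) ξ = ∫ θ (W_max ξ)` and the weak equation `∫ ξ (pθ′)′ = ∫ (qξ − W_max ξ) θ` (p0004:L58–L68).
* §3 `BumpPrimitive` — the Fubini identity `∫ φ₂(x) ∫_a^x h = ∫ Ψ h`, `Ψ(t) = 1_{t>a} ∫_t^{b₀} φ₂`.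
* §4 `SideInterval` — DEVIATION (made explicit, same mathematics): instead of "the primitive
  `f = p∂ξ ∈ C[−λ, λ]`" on the whole interval we work on ONE side interval `J = (a, a + λ/2)`
  where `p ≠ 0`, and show `p ∂ξ = F + m` a.e. on `J` with `F(x) = ∫_a^x (qξ − W_max ξ)`
  continuous, `F(a) = 0`, and the constant `m = −∫ ξ (pφ₂)′ − ∫ φ₂ F` fixed by a bump `φ₂`
  (`∫ φ₂ = 1`, `supp φ₂ ⊂ J`) (`integral_deriv_mul_eq_of_mem_prolateMax`); hence any limit of
  `p ∂g` along `𝓝[≠ ±λ] a` for a representative `g` differentiable off `±λ` equals `m`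
  (`limit_pCoeff_mul_deriv_eq`) — this is clause (v) and avoids matching left/right constants.
* §5 `Functional`/`Vectors`/`Vanishing` — "`f(λ) = ⟨ξ|η₂⟩ + ⟨η|η₃⟩` where the vectors
  `η_j ∈ L²(ℝ)`. Thus `L` is continuous in the graph norm" (p0004:L88–L100): `m = ⟪g₁, ξ⟫ +
  ⟪Ψ, W_max ξ⟫` with `g₁ = −(pφ₂)′ − qΨ ∈ L²`, `Ψ ∈ L²` (`inner_vectors_eq_m`); "for `ξ ∈ 𝒮(ℝ)`
  … `L(ξ) = 0`. By the density of `𝒮(ℝ)` in `Dom W_min` for the graph norm `L` vanishes on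
  `Dom W_min`" (p0004:L100–L102): `inner_vectors_core_eq_zero` (uses `p(a) = 0`) and the
  closed-graph argument `inner_vectors_eq_zero_of_mem_prolateMin` (`W_min ⊂ W_max`,
  `prolateMin_le_prolateMax`, from the symmetry of the core `prolateCore_symmetric`).
* §6 `Witness` — "`η₀ = log|x − λ| ∈ Dom W_max` and `L(η₀) ≠ 0`" (p0004:L102–L104), with a
  smooth cutoff `χ ≡ 1` near `a`: `u₀ = χ log|x − a| ∈ L²`, `W_max u₀ = −v₀′ + q u₀ ∈ L²` with
  `v₀ = p u₀′` smooth (FTC with the countable exceptional set `{a}`), and `p u₀′ → −2a ≠ 0`.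
* §7 `Assembly` — `CM22_lemma_1_2_holds`.

0 `def`s, 0 new facts, no `sorry`; axioms `[propext, Classical.choice, Quot.sound]`.
(Re-landed unchanged 2026-08-26 to rebuild the olean lost in the 11:38–11:49Z build-queue window.)
-/

noncomputable section

open Complex Set MeasureTheory Filter SchwartzMap
open scoped Real Topology FourierTransform ENNReal InnerProductSpace ContDiff

namespace Literature.NumberTheory.ConnesMoscovici2022

open Literature.NumberTheory.ConnesConsani2021 Literature.NumberTheory.ConnesConsani2024

/-! ## §1. Test functions on an open interval and the du Bois-Reymond lemma -/

section TestFunctions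

variable {α β : ℝ}

/-- A smooth bump with integral `1` supported inside `(α, β)`. [folklore] -/
private theorem exists_smooth_bump (hαβ : α < β) :
    ∃ φ : ℝ → ℝ, ContDiff ℝ ∞ φ ∧ HasCompactSupport φ ∧ tsupport φ ⊆ Ioo α β ∧
      (∫ x, φ x) = 1 := by
  have hr : 0 < (β - α) / 4 := by linarith
  let b : ContDiffBump ((α + β) / 2) := ⟨(β - α) / 8, (β - α) / 4, by linarith, by linarith⟩
  refine ⟨b.normed volume, b.contDiff_normed, b.hasCompactSupport_normed, ?_, b.integral_normed⟩
  rw [b.tsupport_normed_eq]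
  intro x hx
  rw [Metric.mem_closedBall, Real.dist_eq, abs_le] at hx
  change -((β - α) / 4) ≤ x - (α + β) / 2 ∧ x - (α + β) / 2 ≤ (β - α) / 4 at hx
  constructor <;> [linarith [hx.1]; linarith [hx.2]]

/-- A compact subset of an open interval lies in a compact subinterval. [folklore] -/
private theorem exists_Icc_of_tsupport_subset {g : ℝ → ℝ} (hαβ : α < β) (hgc : HasCompactSupport g)
    (hgs : tsupport g ⊆ Ioo α β) (hg : Continuous g) :
    ∃ α' β', α < α' ∧ α' ≤ β' ∧ β' < β ∧ (∀ x ≤ α', g x = 0) ∧ (∀ x, β' ≤ x → g x = 0) := by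
  set K : Set ℝ := tsupport g ∪ {(α + β) / 2} with hK
  have hKc : IsCompact K := hgc.union isCompact_singleton
  have hKne : K.Nonempty := ⟨(α + β) / 2, Or.inr rfl⟩
  have hKsub : K ⊆ Ioo α β := union_subset hgs (by
    rintro x (rfl : x = (α + β) / 2); constructor <;> linarith)
  obtain ⟨α', hα'K, hα'le⟩ := hKc.exists_isLeast hKne
  obtain ⟨β', hβ'K, hβ'ge⟩ := hKc.exists_isGreatest hKne
  refine ⟨α', β', (hKsub hα'K).1, hα'le hβ'K, (hKsub hβ'K).2, ?_, ?_⟩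
  · intro x hx
    by_contra hne
    -- `x ∈ support g`, open, so contains points `< α'` of the support unless `x < α'` already
    rcases lt_or_eq_of_le hx with hlt | rfl
    · exact hne (image_eq_zero_of_notMem_tsupport fun hxK ↦ absurd (hα'le (Or.inl hxK)) (not_le.2 hlt))
    · have hopen : IsOpen (Function.support g) := hg.isOpen_support
      obtain ⟨ε, hε, hball⟩ := Metric.isOpen_iff.mp hopen x hne
      have hmem : x - ε / 2 ∈ Function.support g := hball (by
        rw [Metric.mem_ball, Real.dist_eq, show x - ε / 2 - x = -(ε / 2) by ring, abs_neg,
          abs_of_pos (by linarith)]; linarith)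
      have := hα'le (Or.inl (subset_tsupport _ hmem))
      linarith
  · intro x hx
    by_contra hne
    rcases lt_or_eq_of_le hx with hlt | rfl
    · exact hne (image_eq_zero_of_notMem_tsupport fun hxK ↦ absurd (hβ'ge (Or.inl hxK)) (not_le.2 hlt))
    · have hopen : IsOpen (Function.support g) := hg.isOpen_support
      obtain ⟨ε, hε, hball⟩ := Metric.isOpen_iff.mp hopen β' hne
      have hmem : β' + ε / 2 ∈ Function.support g := hball (by
        rw [Metric.mem_ball, Real.dist_eq, show β' + ε / 2 - β' = ε / 2 by ring,
          abs_of_pos (by linarith)]; linarith)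
      have := hβ'ge (Or.inl (subset_tsupport _ hmem))
      linarith

/-- The primitive of a test function with integral zero is a test function. [folklore] -/
private theorem primitive_test {g : ℝ → ℝ} (hαβ : α < β) (hg : ContDiff ℝ ∞ g)
    (hgc : HasCompactSupport g) (hgs : tsupport g ⊆ Ioo α β) (hint : ∫ x, g x = 0) :
    ContDiff ℝ ∞ (fun x ↦ ∫ t in α..x, g t) ∧ HasCompactSupport (fun x ↦ ∫ t in α..x, g t) ∧
      tsupport (fun x ↦ ∫ t in α..x, g t) ⊆ Ioo α β ∧
      ∀ x, deriv (fun x ↦ ∫ t in α..x, g t) x = g x := by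
  have hgcont : Continuous g := hg.continuous
  have hderiv : ∀ x, deriv (fun x ↦ ∫ t in α..x, g t) x = g x :=
    fun x ↦ hgcont.deriv_integral g α x
  have hdiff : Differentiable ℝ (fun x ↦ ∫ t in α..x, g t) :=
    fun x ↦ (hgcont.integral_hasStrictDerivAt α x).hasDerivAt.differentiableAt
  have hsmooth : ContDiff ℝ ∞ (fun x ↦ ∫ t in α..x, g t) := by
    rw [contDiff_infty_iff_deriv]
    refine ⟨hdiff, ?_⟩
    rw [show deriv (fun x ↦ ∫ t in α..x, g t) = g from funext hderiv]
    exact hg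
  obtain ⟨α', β', hα', hα'β', hβ', hlo, hhi⟩ := exists_Icc_of_tsupport_subset hαβ hgc hgs hgcont
  -- the primitive vanishes left of `α'` and right of `β'`
  have hsupp_g : Function.support g ⊆ Ioo α' β' := by
    intro x hx
    rw [Function.mem_support] at hx
    constructor
    · by_contra h; exact hx (hlo x (not_lt.mp h))
    · by_contra h; exact hx (hhi x (not_lt.mp h))
  have hzero : ∀ x, x ∉ Ioo α' β' → (∫ t in α..x, g t) = 0 := by
    intro x hx
    rw [mem_Ioo, not_and_or, not_lt, not_lt] at hx
    rcases hx with hx | hx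
    · -- `x ≤ α'`: `g` vanishes on `[min α x, max α x] ⊆ (-∞, α']`
      rw [intervalIntegral.integral_congr (g := fun _ ↦ (0 : ℝ)) ?_, intervalIntegral.integral_zero]
      intro t ht
      have : t ≤ α' := by
        rcases mem_uIcc.mp ht with ⟨_, h2⟩ | ⟨_, h2⟩
        · exact h2.trans hx
        · exact h2.trans hα'.le
      exact hlo t this
    · -- `β' ≤ x`: the interval contains the support, so the integral is the total integral `0`
      rw [intervalIntegral.integral_eq_integral_of_support_subset, hint]
      exact hsupp_g.trans (Ioo_subset_Ioc_self.trans (Ioc_subset_Ioc hα'.le hx))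
  have hsupp : Function.support (fun x ↦ ∫ t in α..x, g t) ⊆ Ioo α' β' := by
    intro x hx
    by_contra h
    exact hx (hzero x h)
  have htsupp : tsupport (fun x ↦ ∫ t in α..x, g t) ⊆ Icc α' β' :=
    closure_minimal (hsupp.trans Ioo_subset_Icc_self) isClosed_Icc
  refine ⟨hsmooth, ?_, htsupp.trans (Icc_subset_Ioo hα' hβ'), hderiv⟩
  exact HasCompactSupport.of_support_subset_isCompact isCompact_Icc (hsupp.trans Ioo_subset_Icc_self)

/-- A continuous compactly supported `g` with `tsupport g ⊆ U` times a function locally integrable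
on `U` is integrable. [folklore] -/
private theorem integrable_mul_of_tsupport_subset {U : Set ℝ} {v : ℝ → ℂ}
    (hv : LocallyIntegrableOn v U) {g : ℝ → ℝ} (hg : Continuous g) (hgc : HasCompactSupport g)
    (hgs : tsupport g ⊆ U) : Integrable (fun x ↦ (g x : ℂ) * v x) := by
  have heq : (tsupport g).indicator (fun x ↦ (g x : ℂ) * v x) = fun x ↦ (g x : ℂ) * v x := by
    apply indicator_eq_self.2
    apply Function.support_subset_iff'.2
    intro x hx
    simp [image_eq_zero_of_notMem_tsupport hx]
  rw [← heq, integrable_indicator_iff (isClosed_tsupport g).measurableSet]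
  have h1 : IntegrableOn v (tsupport g) := hv.integrableOn_compact_subset hgs hgc
  have h2 : MemLp (fun x ↦ (g x : ℂ)) ∞ (volume.restrict (tsupport g)) :=
    (Complex.continuous_ofReal.comp hg).memLp_top_of_hasCompactSupport
      (hgc.comp_left Complex.ofReal_zero) _
  exact (h1.integrable.smul_of_top_right h2).congr (Eventually.of_forall fun x ↦ rfl)

/-- **du Bois-Reymond lemma** (order one, weak form on an open interval): if a locally integrable
`v` on `(α, β)` satisfies `∫ Θ′ v = 0` for every test function `Θ` supported in `(α, β)`, then `v`
is a.e. constant on `(α, β)`. [folklore] -/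
private theorem ae_eq_const_of_integral_deriv_mul_eq_zero (hαβ : α < β) {v : ℝ → ℂ}
    (hv : LocallyIntegrableOn v (Ioo α β))
    (h : ∀ Θ : ℝ → ℝ, ContDiff ℝ ∞ Θ → HasCompactSupport Θ → tsupport Θ ⊆ Ioo α β →
      ∫ x, ((deriv Θ x : ℝ) : ℂ) * v x = 0) :
    ∃ k : ℂ, ∀ᵐ x, x ∈ Ioo α β → v x = k := by
  obtain ⟨φ₂, hφ₂, hφ₂c, hφ₂s, hφ₂i⟩ := exists_smooth_bump hαβ
  refine ⟨∫ x, (φ₂ x : ℂ) * v x, ?_⟩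
  set k : ℂ := ∫ x, (φ₂ x : ℂ) * v x with hk
  have hvk : LocallyIntegrableOn (fun x ↦ v x - k) (Ioo α β) :=
    hv.sub (locallyIntegrableOn_const _)
  have key := isOpen_Ioo.ae_eq_zero_of_integral_contDiff_smul_eq_zero (μ := volume) hvk ?_
  · filter_upwards [key] with x hx hxU
    exact sub_eq_zero.mp (hx hxU)
  intro g hg hgc hgs
  -- `g₀ := g − (∫ g) φ₂` has integral zero; its primitive is a test function
  set c : ℝ := ∫ x, g x with hc
  set g₀ : ℝ → ℝ := fun x ↦ g x - c * φ₂ x with hg₀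
  have hg₀s : ContDiff ℝ ∞ g₀ := hg.sub (contDiff_const.mul hφ₂)
  have hg₀c : HasCompactSupport g₀ := hgc.sub (hφ₂c.mul_left)
  have hg₀supp : tsupport g₀ ⊆ Ioo α β :=
    (tsupport_sub g _).trans (union_subset hgs ((tsupport_mul_subset_right).trans hφ₂s))
  have hgi : Integrable g := hg.continuous.integrable_of_hasCompactSupport hgc
  have hφ₂int : Integrable φ₂ := hφ₂.continuous.integrable_of_hasCompactSupport hφ₂c
  have hg₀i : ∫ x, g₀ x = 0 := by
    simp only [hg₀]
    rw [integral_sub hgi (hφ₂int.const_mul c), integral_const_mul, hφ₂i, mul_one, sub_self]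
  obtain ⟨hΘs, hΘc, hΘsupp, hΘd⟩ := primitive_test hαβ hg₀s hg₀c hg₀supp hg₀i
  have h0 := h _ hΘs hΘc hΘsupp
  simp_rw [hΘd] at h0
  simp only [hg₀] at h0
  -- `∫ g₀ v = ∫ g v − c k = 0`
  have hgv : Integrable (fun x ↦ (g x : ℂ) * v x) :=
    integrable_mul_of_tsupport_subset hv hg.continuous hgc hgs
  have hφv : Integrable (fun x ↦ (φ₂ x : ℂ) * v x) :=
    integrable_mul_of_tsupport_subset hv hφ₂.continuous hφ₂c hφ₂s
  have h1 : ∫ x, (g x : ℂ) * v x = c * k := by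
    have : (fun x ↦ ((g x - c * φ₂ x : ℝ) : ℂ) * v x) =
        fun x ↦ (g x : ℂ) * v x - (c : ℂ) * ((φ₂ x : ℂ) * v x) := by
      funext x; push_cast; ring
    rw [this, integral_sub hgv (hφv.const_mul _), integral_const_mul] at h0
    exact sub_eq_zero.mp h0
  -- conclude `∫ g • (v − k) = 0`
  have h2 : ∫ x, (g x : ℂ) * k = c * k := by
    rw [integral_mul_const, integral_complex_ofReal, ← hc]
  calc ∫ x, g x • (v x - k) = ∫ x, ((g x : ℂ) * v x - (g x : ℂ) * k) := by
        congr 1; funext x; rw [Complex.real_smul, mul_sub]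
    _ = (∫ x, (g x : ℂ) * v x) - ∫ x, (g x : ℂ) * k := integral_sub hgv (hgi.ofReal.mul_const k)
    _ = 0 := by rw [h1, h2, sub_self]

/-- Frame of a test function: `supp Θ, supp Θ′ ⊆ (a, b)` with `α < a < b < β`. [folklore] -/
private theorem exists_frame {Θ : ℝ → ℝ} (hαβ : α < β) (hΘ : ContDiff ℝ ∞ Θ)
    (hΘc : HasCompactSupport Θ) (hΘs : tsupport Θ ⊆ Ioo α β) :
    ∃ a b, α < a ∧ a < b ∧ b < β ∧ Function.support Θ ⊆ Ioo a b ∧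
      Function.support (deriv Θ) ⊆ Ioo a b := by
  obtain ⟨α', β', hα', hα'β', hβ', hlo, hhi⟩ :=
    exists_Icc_of_tsupport_subset hαβ hΘc hΘs hΘ.continuous
  have hsupp : Function.support Θ ⊆ Ioo α' β' := by
    intro x hx
    rw [Function.mem_support] at hx
    constructor
    · by_contra h; exact hx (hlo x (not_lt.mp h))
    · by_contra h; exact hx (hhi x (not_lt.mp h))
  have htsupp : tsupport Θ ⊆ Icc α' β' :=
    closure_minimal (hsupp.trans Ioo_subset_Icc_self) isClosed_Icc
  exact ⟨(α + α') / 2, (β' + β) / 2, by linarith, by linarith, by linarith,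
    hsupp.trans (Ioo_subset_Ioo (by linarith) (by linarith)),
    (support_deriv_subset.trans htsupp).trans (Icc_subset_Ioo (by linarith) (by linarith))⟩

/-- **du Bois-Reymond with a continuous right-hand side**: if `∫ Θ′ v = −∫ Θ w` for every test
function `Θ` on `(α, β)` with `w` continuous there, then `v` agrees a.e. on `(α, β)` with a
primitive of `w` plus a constant. [folklore] -/
private theorem ae_eq_primitive_add_const (hαβ : α < β) {v w : ℝ → ℂ}
    (hv : LocallyIntegrableOn v (Ioo α β)) (hw : ContinuousOn w (Ioo α β)) {x₁ : ℝ}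
    (hx₁ : x₁ ∈ Ioo α β)
    (h : ∀ Θ : ℝ → ℝ, ContDiff ℝ ∞ Θ → HasCompactSupport Θ → tsupport Θ ⊆ Ioo α β →
      ∫ x, ((deriv Θ x : ℝ) : ℂ) * v x = -∫ x, (Θ x : ℂ) * w x) :
    ∃ k : ℂ, ∀ᵐ x, x ∈ Ioo α β → v x = (∫ t in x₁..x, w t) + k := by
  set G : ℝ → ℂ := fun x ↦ ∫ t in x₁..x, w t with hG
  have hGd : ∀ x ∈ Ioo α β, HasDerivAt G (w x) x := by
    intro x hx
    have hsub : uIcc x₁ x ⊆ Ioo α β := fun y hy ↦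
      ⟨lt_of_lt_of_le (lt_min hx₁.1 hx.1) hy.1, lt_of_le_of_lt hy.2 (max_lt hx₁.2 hx.2)⟩
    exact intervalIntegral.integral_hasDerivAt_right ((hw.mono hsub).intervalIntegrable)
      (hw.stronglyMeasurableAtFilter isOpen_Ioo x hx) (hw.continuousAt (isOpen_Ioo.mem_nhds hx))
  have hGc : ContinuousOn G (Ioo α β) := fun x hx ↦ (hGd x hx).continuousAt.continuousWithinAt
  have hGli : LocallyIntegrableOn G (Ioo α β) := hGc.locallyIntegrableOn measurableSet_Ioo
  have hvG : LocallyIntegrableOn (fun x ↦ v x - G x) (Ioo α β) := hv.sub hGli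
  suffices hyp : ∀ Θ : ℝ → ℝ, ContDiff ℝ ∞ Θ → HasCompactSupport Θ → tsupport Θ ⊆ Ioo α β →
      ∫ x, ((deriv Θ x : ℝ) : ℂ) * (v x - G x) = 0 by
    obtain ⟨k, hk⟩ := ae_eq_const_of_integral_deriv_mul_eq_zero hαβ hvG hyp
    exact ⟨k, by filter_upwards [hk] with x hx hxU; rw [sub_eq_iff_eq_add.mp (hx hxU), add_comm]⟩
  intro Θ hΘ hΘc hΘs
  obtain ⟨a, b, ha, hab, hb, hsΘ, hsΘ'⟩ := exists_frame hαβ hΘ hΘc hΘs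
  have hIcc : Icc a b ⊆ Ioo α β := Icc_subset_Ioo ha hb
  have hΘd : ∀ x, HasDerivAt (fun y ↦ (Θ y : ℂ)) ((deriv Θ x : ℝ) : ℂ) x := fun x ↦
    ((hΘ.differentiable (by simp)).differentiableAt.hasDerivAt).ofReal_comp
  have hΘ'cont : Continuous fun x ↦ ((deriv Θ x : ℝ) : ℂ) :=
    Complex.continuous_ofReal.comp (hΘ.continuous_deriv (by simp))
  -- integration by parts on `[a, b]`
  have hparts := intervalIntegral.integral_deriv_mul_eq_sub (a := a) (b := b)
    (u := fun y ↦ (Θ y : ℂ)) (v := G) (u' := fun x ↦ ((deriv Θ x : ℝ) : ℂ)) (v' := w)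
    (fun x _ ↦ hΘd x) (fun x hx ↦ hGd x (hIcc (by rwa [uIcc_of_le hab.le] at hx)))
    (hΘ'cont.intervalIntegrable a b)
    ((hw.mono ((uIcc_of_le hab.le).symm ▸ hIcc)).intervalIntegrable)
  have hΘa : (Θ a : ℂ) = 0 := by
    rw [show Θ a = 0 from by
      by_contra hne; exact (lt_irrefl a) (hsΘ (Function.mem_support.mpr hne)).1]; simp
  have hΘb : (Θ b : ℂ) = 0 := by
    rw [show Θ b = 0 from by
      by_contra hne; exact (lt_irrefl b) (hsΘ (Function.mem_support.mpr hne)).2]; simp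
  rw [hΘa, hΘb, zero_mul, zero_mul, sub_zero] at hparts
  -- the two summands are separately integrable on `[a, b]`
  have hi1 : IntervalIntegrable (fun x ↦ ((deriv Θ x : ℝ) : ℂ) * G x) volume a b :=
    (hΘ'cont.continuousOn.mul (hGc.mono ((uIcc_of_le hab.le).symm ▸ hIcc))).intervalIntegrable
  have hi2 : IntervalIntegrable (fun x ↦ (Θ x : ℂ) * w x) volume a b :=
    ((Complex.continuous_ofReal.comp hΘ.continuous).continuousOn.mul
      (hw.mono ((uIcc_of_le hab.le).symm ▸ hIcc))).intervalIntegrable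
  rw [intervalIntegral.integral_add hi1 hi2] at hparts
  -- whole-line integrals are integrals over `[a, b]`
  have hsupp1 : Function.support (fun x ↦ ((deriv Θ x : ℝ) : ℂ) * G x) ⊆ Ioc a b := by
    intro x hx
    rw [Function.mem_support] at hx
    have : deriv Θ x ≠ 0 := fun h0 ↦ hx (by rw [h0]; simp)
    exact Ioo_subset_Ioc_self (hsΘ' (Function.mem_support.mpr this))
  have hsupp2 : Function.support (fun x ↦ (Θ x : ℂ) * w x) ⊆ Ioc a b := by
    intro x hx
    rw [Function.mem_support] at hx
    have : Θ x ≠ 0 := fun h0 ↦ hx (by rw [h0]; simp)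
    exact Ioo_subset_Ioc_self (hsΘ (Function.mem_support.mpr this))
  have e1 : ∫ x, ((deriv Θ x : ℝ) : ℂ) * G x = ∫ x in a..b, ((deriv Θ x : ℝ) : ℂ) * G x :=
    (intervalIntegral.integral_eq_integral_of_support_subset hsupp1).symm
  have e2 : ∫ x, (Θ x : ℂ) * w x = ∫ x in a..b, (Θ x : ℂ) * w x :=
    (intervalIntegral.integral_eq_integral_of_support_subset hsupp2).symm
  -- assemble
  have hI1 : Integrable (fun x ↦ ((deriv Θ x : ℝ) : ℂ) * v x) :=
    integrable_mul_of_tsupport_subset hv (hΘ.continuous_deriv (by simp)) hΘc.deriv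
      (tsupport_deriv_subset.trans hΘs)
  have hI2 : Integrable (fun x ↦ ((deriv Θ x : ℝ) : ℂ) * G x) :=
    integrable_mul_of_tsupport_subset hGli (hΘ.continuous_deriv (by simp)) hΘc.deriv
      (tsupport_deriv_subset.trans hΘs)
  calc ∫ x, ((deriv Θ x : ℝ) : ℂ) * (v x - G x)
      = (∫ x, ((deriv Θ x : ℝ) : ℂ) * v x) - ∫ x, ((deriv Θ x : ℝ) : ℂ) * G x := by
        rw [← integral_sub hI1 hI2]; congr 1; funext x; ring
    _ = 0 := by rw [h Θ hΘ hΘc hΘs, e1, e2]; linear_combination -hparts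

/-- **Integration by parts against a primitive of an `L¹` function** (Fubini on the triangle):
for `h ∈ L¹(α, β)` and a test function `Θ` on `(α, β)`,
`∫ Θ′(x) (∫_α^x h) dx = −∫ Θ h`. [folklore] -/
private theorem integral_deriv_mul_primitive (hαβ : α < β) {h : ℝ → ℂ}
    (hh : IntegrableOn h (Ioo α β)) {Θ : ℝ → ℝ} (hΘ : ContDiff ℝ ∞ Θ)
    (hΘc : HasCompactSupport Θ) (hΘs : tsupport Θ ⊆ Ioo α β) :
    ∫ x, ((deriv Θ x : ℝ) : ℂ) * (∫ t in α..x, h t) = -∫ x, (Θ x : ℂ) * h x := by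
  obtain ⟨a, b, ha, hab, hb, hsΘ, hsΘ'⟩ := exists_frame hαβ hΘ hΘc hΘs
  set D : ℝ → ℂ := fun x ↦ ((deriv Θ x : ℝ) : ℂ) with hD
  have hDcont : Continuous D := Complex.continuous_ofReal.comp (hΘ.continuous_deriv (by simp))
  have hD0 : ∀ x, x ∉ Ioo a b → D x = 0 := fun x hx ↦ by
    have : deriv Θ x = 0 := by
      by_contra hne; exact hx (hsΘ' (Function.mem_support.mpr hne))
    simp [hD, this]
  have hΘ0 : ∀ x, x ∉ Ioo a b → (Θ x : ℂ) = 0 := fun x hx ↦ by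
    have : Θ x = 0 := by
      by_contra hne; exact hx (hsΘ (Function.mem_support.mpr hne))
    simp [this]
  have hΘd : ∀ x, HasDerivAt (fun y ↦ (Θ y : ℂ)) (D x) x := fun x ↦
    ((hΘ.differentiable (by simp)).differentiableAt.hasDerivAt).ofReal_comp
  -- the box `S = (α, b]`, the kernel `K x t = 1_{t ≤ x} Θ′(x) h(t)`
  set S : Set ℝ := Ioc α b with hS
  have hSsub : S ⊆ Ioo α β := fun x hx ↦ ⟨hx.1, lt_of_le_of_lt hx.2 hb⟩
  have hhS : Integrable h (volume.restrict S) := hh.mono_set hSsub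
  have hDS : Integrable D (volume.restrict S) :=
    (hDcont.integrable_of_hasCompactSupport (hΘc.deriv.comp_left Complex.ofReal_zero)).restrict
  set K : ℝ → ℝ → ℂ := fun x t ↦ if t ≤ x then D x * h t else 0 with hK
  have hKint : Integrable (Function.uncurry K) ((volume.restrict S).prod (volume.restrict S)) := by
    have := (hDS.mul_prod hhS).indicator
      (measurableSet_le measurable_snd measurable_fst : MeasurableSet {p : ℝ × ℝ | p.2 ≤ p.1})
    refine this.congr (Eventually.of_forall fun p ↦ ?_)
    simp only [Function.uncurry, hK, indicator, mem_setOf_eq]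
  have hswap := integral_integral_swap hKint
  -- order 1: `∫_x ∫_t K = ∫ Θ′ F`
  have h1 : ∀ x ∈ S, ∫ t in S, K x t = D x * ∫ t in α..x, h t := by
    intro x hx
    have e : (fun t ↦ K x t) = fun t ↦ D x * (Iic x).indicator h t := by
      funext t; simp only [hK, indicator, mem_Iic]; split_ifs <;> simp
    rw [e, integral_const_mul, setIntegral_indicator measurableSet_Iic,
      intervalIntegral.integral_of_le hx.1.le]
    congr 2
    rw [hS, Ioc_inter_Iic, min_eq_right hx.2]
  have hL : ∫ x in S, ∫ t in S, K x t = ∫ x, D x * ∫ t in α..x, h t := by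
    rw [setIntegral_congr_fun measurableSet_Ioc h1]
    refine setIntegral_eq_integral_of_forall_compl_eq_zero fun x hx ↦ ?_
    rw [hD0 x (fun hx' ↦ hx ⟨lt_trans ha hx'.1, hx'.2.le⟩), zero_mul]
  -- order 2: `∫_t ∫_x K = -∫ Θ h`
  have h2 : ∀ t ∈ S, ∫ x in S, K x t = -(Θ t : ℂ) * h t := by
    intro t ht
    have e : (fun x ↦ K x t) = fun x ↦ (Ici t).indicator D x * h t := by
      funext x; simp only [hK, indicator, mem_Ici]; split_ifs <;> simp
    rw [e, integral_mul_const, setIntegral_indicator measurableSet_Ici]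
    have hset : S ∩ Ici t = Icc t b := by
      ext x; simp only [hS, mem_inter_iff, mem_Ioc, mem_Ici, mem_Icc]
      constructor
      · rintro ⟨⟨_, h2⟩, h3⟩; exact ⟨h3, h2⟩
      · rintro ⟨h1, h2⟩; exact ⟨⟨lt_of_lt_of_le ht.1 h1, h2⟩, h1⟩
    rw [hset, integral_Icc_eq_integral_Ioc, ← intervalIntegral.integral_of_le ht.2,
      intervalIntegral.integral_eq_sub_of_hasDerivAt (fun x _ ↦ hΘd x)
        (hDcont.intervalIntegrable _ _),
      hΘ0 b (fun h' ↦ (lt_irrefl b) h'.2)]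
    ring
  have hR : ∫ t in S, ∫ x in S, K x t = -∫ t, (Θ t : ℂ) * h t := by
    rw [setIntegral_congr_fun measurableSet_Ioc h2, ← integral_neg]
    refine (setIntegral_eq_integral_of_forall_compl_eq_zero fun t ht ↦ ?_).trans ?_
    · rw [hΘ0 t (fun ht' ↦ ht ⟨lt_trans ha ht'.1, ht'.2.le⟩), neg_zero, zero_mul]
    · congr 1; funext t; ring
  rw [← hL, hswap, hR]

end TestFunctions

/-! ## §2. The weak identities satisfied by `ξ ∈ dom W_max` -/

section WeakIdentities

variable (lam : ℝ)

/-- A Schwartz function times an `L²` function is integrable. [folklore] -/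
private theorem integrable_schwartz_mul_Lp (θ : 𝓢(ℝ, ℂ)) (u : L2R) :
    Integrable (fun x ↦ θ x * u x) :=
  (θ.memLp 2 volume).integrable_mul (Lp.memLp u)

/-- `W θ = −(p θ′)′ + q θ` pointwise, in `pCoeff`/`qCoeff` notation. [cite: ConnesMoscovici2022, §1 eq. (1.1) (= arXiv (2.1), chunk p0004:L5–L9)] -/
theorem prolateSchwartz_apply' (θ : 𝓢(ℝ, ℂ)) (x : ℝ) :
    prolateSchwartz lam θ x =
      -deriv (fun y ↦ pCoeff lam y * deriv θ y) x + qCoeff lam x * θ x := by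
  rw [prolateSchwartz_apply, prolateWaveOpFun]
  have e : (fun y ↦ ((lam ^ 2 - y ^ 2 : ℝ) : ℂ) * deriv θ y) = fun y ↦ pCoeff lam y * deriv θ y := by
    funext y; rfl
  rw [e, qCoeff]
  push_cast
  ring

/-- `(p θ′)′` is (the underlying function of) a Schwartz map. [folklore] -/
private theorem deriv_pCoeff_mul_deriv_eq (θ : 𝓢(ℝ, ℂ)) (x : ℝ) :
    deriv (fun y ↦ pCoeff lam y * deriv θ y) x =
      (derivCLM ℂ ℂ (smulLeftCLM ℂ (pCoeff lam) (derivCLM ℂ ℂ θ))) x := by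
  have e : ⇑(smulLeftCLM ℂ (pCoeff lam) (derivCLM ℂ ℂ θ)) = fun y ↦ pCoeff lam y * deriv θ y := by
    funext y
    rw [smulLeftCLM_apply_apply (pCoeff_hasTemperateGrowth lam), derivCLM_apply, smul_eq_mul]
  rw [derivCLM_apply, e]

/-- RH-FREE (PROVED). **The adjoint identity, bilinear form**: for `ξ ∈ dom W_max` and Schwartz
`θ`, `∫ (Wθ)·ξ = ∫ θ·(W_max ξ)` — i.e. `W_max ξ` is the distribution `Wξ` ("with `Wξ` viewed as a
tempered distribution", eq. (1.2)); obtained from Mathlib's `⟪W_max ξ, θ̄⟫ = ⟪ξ, W θ̄⟫` and the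
reality of `W`. [cite: ConnesMoscovici2022, §1 eq. (1.2) and proof of Lemma 1.2 (= arXiv (2.2), chunk p0004:L16–L22, L58–L62)] -/
theorem integral_prolateSchwartz_mul_eq (ξ : (prolateMax lam).domain) (θ : 𝓢(ℝ, ℂ)) :
    ∫ x, prolateSchwartz lam θ x * (ξ : L2R) x = ∫ x, θ x * (prolateMax lam ξ : L2R) x := by
  set θc : 𝓢(ℝ, ℂ) := SchwartzMap.postcompCLM (Complex.conjCLE : ℂ →L[ℝ] ℂ) θ with hθc
  have hθc_apply : ∀ x, θc x = star (θ x) := fun x ↦ rfl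
  have hadj := LinearPMap.adjoint_isFormalAdjoint (T := prolateCore lam) dense_schwartzL2 ξ
    ⟨schwartzToL2 θc, LinearMap.mem_range_self _ θc⟩
  rw [prolateCore_apply] at hadj
  -- `⟪W_max ξ, θ̄⟫ = ⟪ξ, W θ̄⟫` as integrals
  change ⟪(prolateMax lam ξ : L2R), (θc.toLp 2 volume : L2R)⟫_ℂ =
    ⟪((ξ : L2R)), ((prolateSchwartz lam θc).toLp 2 volume : L2R)⟫_ℂ at hadj
  rw [L2.inner_def, L2.inner_def] at hadj
  have h1 : ∫ x, ⟪(prolateMax lam ξ : L2R) x, (θc.toLp 2 volume : L2R) x⟫_ℂ =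
      ∫ x, star (θ x * (prolateMax lam ξ : L2R) x) := by
    refine integral_congr_ae ?_
    filter_upwards [θc.coeFn_toLp 2 volume] with x hx
    rw [hx, hθc_apply]
    simp [mul_comm]
  have h2 : ∫ x, ⟪((ξ : L2R)) x, ((prolateSchwartz lam θc).toLp 2 volume : L2R) x⟫_ℂ =
      ∫ x, star (prolateSchwartz lam θ x * (ξ : L2R) x) := by
    refine integral_congr_ae ?_
    filter_upwards [(prolateSchwartz lam θc).coeFn_toLp 2 volume] with x hx
    rw [hx, prolateSchwartz_apply, show (⇑θc : ℝ → ℂ) = fun y ↦ star (θ y) from funext hθc_apply,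
      prolateWaveOpFun_star, ← prolateSchwartz_apply]
    simp [mul_comm]
  rw [h1, h2] at hadj
  simp only [Complex.star_def] at hadj
  rw [integral_conj, integral_conj] at hadj
  have := congrArg (starRingEnd ℂ) hadj
  simpa using this.symm

/-- RH-FREE (PROVED). **The weak equation** `(p ξ′)′ = q ξ − W_max ξ`: for `ξ ∈ dom W_max` and
Schwartz `θ`, `∫ ξ·(pθ′)′ = ∫ (qξ − W_max ξ)·θ` ("Let `η = W_max ξ`, one has by definition
`⟨η | φ⟩ = ⟨ξ | W_min φ⟩ = ∫ ξ (∂(p∂φ) + qφ)`"). [cite: ConnesMoscovici2022, proof of Lemma 1.2 (= arXiv Lemma 2.2, chunk p0004:L58–L68)] -/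
theorem integral_mul_deriv_pCoeff_mul_deriv (ξ : (prolateMax lam).domain) (θ : 𝓢(ℝ, ℂ)) :
    ∫ x, (ξ : L2R) x * deriv (fun y ↦ pCoeff lam y * deriv θ y) x =
      ∫ x, (qCoeff lam x * (ξ : L2R) x - (prolateMax lam ξ : L2R) x) * θ x := by
  have h := integral_prolateSchwartz_mul_eq lam ξ θ
  simp_rw [prolateSchwartz_apply'] at h
  have hi1 : Integrable (fun x ↦ deriv (fun y ↦ pCoeff lam y * deriv θ y) x * (ξ : L2R) x) := by
    simp_rw [deriv_pCoeff_mul_deriv_eq]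
    exact integrable_schwartz_mul_Lp _ _
  have hi2 : Integrable (fun x ↦ qCoeff lam x * θ x * (ξ : L2R) x) := by
    have : (fun x ↦ qCoeff lam x * θ x * (ξ : L2R) x) =
        fun x ↦ (smulLeftCLM ℂ (qCoeff lam) θ) x * (ξ : L2R) x := by
      funext x; rw [smulLeftCLM_apply_apply (qCoeff_hasTemperateGrowth lam), smul_eq_mul]
    rw [this]; exact integrable_schwartz_mul_Lp _ _
  have hi3 : Integrable (fun x ↦ θ x * (prolateMax lam ξ : L2R) x) := integrable_schwartz_mul_Lp _ _
  have e : (fun x ↦ (-deriv (fun y ↦ pCoeff lam y * deriv θ y) x + qCoeff lam x * θ x) * (ξ : L2R) x)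
      = fun x ↦ -(deriv (fun y ↦ pCoeff lam y * deriv θ y) x * (ξ : L2R) x) +
          qCoeff lam x * θ x * (ξ : L2R) x := by
    funext x; ring
  have hi1' : Integrable (fun x ↦ -(deriv (fun y ↦ pCoeff lam y * deriv θ y) x * (ξ : L2R) x)) :=
    hi1.neg
  rw [e, integral_add hi1' hi2, integral_neg] at h
  have e2 : (fun x ↦ (qCoeff lam x * (ξ : L2R) x - (prolateMax lam ξ : L2R) x) * θ x) =
      fun x ↦ qCoeff lam x * θ x * (ξ : L2R) x - θ x * (prolateMax lam ξ : L2R) x := by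
    funext x; ring
  rw [e2, integral_sub hi2 hi3, ← h]
  have e3 : (fun x ↦ (ξ : L2R) x * deriv (fun y ↦ pCoeff lam y * deriv θ y) x) =
      fun x ↦ deriv (fun y ↦ pCoeff lam y * deriv θ y) x * (ξ : L2R) x := by
    funext x; ring
  rw [e3]
  ring

end WeakIdentities

/-! ## §3. Fubini against a bump: `∫ φ₂ F = ∫ Ψ h` -/

section BumpPrimitive

variable {α β : ℝ}

/-- **Fubini on the triangle, bump version**: for `h ∈ L¹(α, β)`, a test function `φ` on `(α, β)`
and `Ψ(t) = 1_{(α, β]}(t) ∫_t^β φ`, one has `∫ φ(x) (∫_α^x h) dx = ∫ Ψ h`.  (Integration by parts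
against the primitive `F` of `h`, `F(α) = 0`, with the non-compactly-supported `Ψ`.) [folklore] -/
private theorem integral_bump_mul_primitive (hαβ : α < β) {h : ℝ → ℂ}
    (hh : IntegrableOn h (Ioo α β)) {φ : ℝ → ℝ} (hφ : ContDiff ℝ ∞ φ)
    (hφc : HasCompactSupport φ) (hφs : tsupport φ ⊆ Ioo α β) :
    ∫ x, (φ x : ℂ) * (∫ t in α..x, h t) =
      ∫ t, (Ioc α β).indicator (fun t ↦ ((∫ x in t..β, φ x : ℝ) : ℂ)) t * h t := by
  obtain ⟨a, b, ha, hab, hb, hsφ, -⟩ := exists_frame hαβ hφ hφc hφs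
  set D : ℝ → ℂ := fun x ↦ ((φ x : ℝ) : ℂ) with hD
  have hDcont : Continuous D := Complex.continuous_ofReal.comp hφ.continuous
  have hφ0 : ∀ x, x ∉ Ioo a b → φ x = 0 := fun x hx ↦ by
    by_contra hne; exact hx (hsφ (Function.mem_support.mpr hne))
  have hD0 : ∀ x, x ∉ Ioo a b → D x = 0 := fun x hx ↦ by simp [hD, hφ0 x hx]
  -- the box `S = (α, b]`
  set S : Set ℝ := Ioc α b with hS
  have hSsub : S ⊆ Ioo α β := fun x hx ↦ ⟨hx.1, lt_of_le_of_lt hx.2 hb⟩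
  have hhS : Integrable h (volume.restrict S) := hh.mono_set hSsub
  have hDS : Integrable D (volume.restrict S) :=
    (hDcont.integrable_of_hasCompactSupport (hφc.comp_left Complex.ofReal_zero)).restrict
  set K : ℝ → ℝ → ℂ := fun x t ↦ if t ≤ x then D x * h t else 0 with hK
  have hKint : Integrable (Function.uncurry K) ((volume.restrict S).prod (volume.restrict S)) := by
    have := (hDS.mul_prod hhS).indicator
      (measurableSet_le measurable_snd measurable_fst : MeasurableSet {p : ℝ × ℝ | p.2 ≤ p.1})
    refine this.congr (Eventually.of_forall fun p ↦ ?_)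
    simp only [Function.uncurry, hK, indicator, mem_setOf_eq]
  have hswap := integral_integral_swap hKint
  -- order 1
  have h1 : ∀ x ∈ S, ∫ t in S, K x t = D x * ∫ t in α..x, h t := by
    intro x hx
    have e : (fun t ↦ K x t) = fun t ↦ D x * (Iic x).indicator h t := by
      funext t; simp only [hK, indicator, mem_Iic]; split_ifs <;> simp
    rw [e, integral_const_mul, setIntegral_indicator measurableSet_Iic,
      intervalIntegral.integral_of_le hx.1.le]
    congr 2
    rw [hS, Ioc_inter_Iic, min_eq_right hx.2]
  have hL : ∫ x in S, ∫ t in S, K x t = ∫ x, D x * ∫ t in α..x, h t := by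
    rw [setIntegral_congr_fun measurableSet_Ioc h1]
    refine setIntegral_eq_integral_of_forall_compl_eq_zero fun x hx ↦ ?_
    rw [hD0 x (fun hx' ↦ hx ⟨lt_trans ha hx'.1, hx'.2.le⟩), zero_mul]
  -- the tail integral `∫_t^β φ = ∫_t^b φ` for `t ∈ S`
  have htail : ∀ t ∈ S, (∫ x in t..β, φ x) = ∫ x in t..b, φ x := by
    intro t ht
    rw [← intervalIntegral.integral_add_adjacent_intervals (b := b)
      (hφ.continuous.intervalIntegrable _ _) (hφ.continuous.intervalIntegrable _ _)]
    have : (∫ x in b..β, φ x) = 0 := by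
      rw [intervalIntegral.integral_congr (g := fun _ ↦ (0 : ℝ)) ?_, intervalIntegral.integral_zero]
      intro x hx
      rw [uIcc_of_le hb.le] at hx
      exact hφ0 x (fun hx' ↦ (lt_irrefl b) (lt_of_le_of_lt hx.1 hx'.2))
    rw [this, add_zero]
  -- order 2
  have h2 : ∀ t ∈ S, ∫ x in S, K x t = ((∫ x in t..β, φ x : ℝ) : ℂ) * h t := by
    intro t ht
    have e : (fun x ↦ K x t) = fun x ↦ (Ici t).indicator D x * h t := by
      funext x; simp only [hK, indicator, mem_Ici]; split_ifs <;> simp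
    rw [e, integral_mul_const, setIntegral_indicator measurableSet_Ici]
    have hset : S ∩ Ici t = Icc t b := by
      ext x; simp only [hS, mem_inter_iff, mem_Ioc, mem_Ici, mem_Icc]
      constructor
      · rintro ⟨⟨_, h2⟩, h3⟩; exact ⟨h3, h2⟩
      · rintro ⟨h1, h2⟩; exact ⟨⟨lt_of_lt_of_le ht.1 h1, h2⟩, h1⟩
    rw [hset, integral_Icc_eq_integral_Ioc, ← intervalIntegral.integral_of_le ht.2, htail t ht,
      hD, intervalIntegral.integral_ofReal]
  have hR : ∫ t in S, ∫ x in S, K x t =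
      ∫ t, (Ioc α β).indicator (fun t ↦ ((∫ x in t..β, φ x : ℝ) : ℂ)) t * h t := by
    rw [setIntegral_congr_fun measurableSet_Ioc h2]
    have H : ∀ t, t ∉ S →
        (Ioc α β).indicator (fun t ↦ ((∫ x in t..β, φ x : ℝ) : ℂ)) t * h t = 0 := by
      intro t ht
      by_cases hta : t ∈ Ioc α β
      · rw [indicator_of_mem hta]
        have htb : b < t := by
          by_contra hle; exact ht ⟨hta.1, not_lt.mp hle⟩
        have : (∫ x in t..β, φ x) = 0 := by
          rw [intervalIntegral.integral_congr (g := fun _ ↦ (0 : ℝ)) ?_,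
            intervalIntegral.integral_zero]
          intro x hx
          rw [uIcc_of_le hta.2] at hx
          exact hφ0 x (fun hx' ↦ (lt_irrefl b) (lt_trans htb (lt_of_le_of_lt hx.1 hx'.2)))
        rw [this]; simp
      · rw [indicator_of_notMem hta, zero_mul]
    rw [← setIntegral_eq_integral_of_forall_compl_eq_zero (s := S) H]
    refine setIntegral_congr_fun measurableSet_Ioc fun t ht ↦ ?_
    rw [indicator_of_mem (show t ∈ Ioc α β from ⟨ht.1, (hSsub ht).2.le⟩)]
  rw [← hL, hswap, hR]

end BumpPrimitive

/-! ## §4. The one-sided analysis on `J = (a, b₀)`: `p ξ′ = F + m` weakly, hence classically -/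

section SideInterval

variable {lam a b₀ : ℝ}

/-- A test function supported where `P ≠ 0`, divided by the smooth `P`, is smooth. [folklore] -/
private theorem contDiff_div_of_tsupport {Θ P : ℝ → ℝ} {U : Set ℝ} (hΘ : ContDiff ℝ ∞ Θ)
    (hP : ContDiff ℝ ∞ P) (hΘs : tsupport Θ ⊆ U) (hPU : ∀ x ∈ U, P x ≠ 0) :
    ContDiff ℝ ∞ (fun x ↦ Θ x / P x) := by
  rw [contDiff_iff_contDiffAt]
  intro x
  by_cases hx : x ∈ tsupport Θ
  · exact hΘ.contDiffAt.div hP.contDiffAt (hPU x (hΘs hx))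
  · have h0 : (fun y ↦ Θ y / P y) =ᶠ[𝓝 x] fun _ ↦ 0 := by
      filter_upwards [notMem_tsupport_iff_eventuallyEq.mp hx] with y hy
      rw [hy, Pi.zero_apply, zero_div]
    exact (contDiffAt_const (c := (0 : ℝ))).congr_of_eventuallyEq h0

/-- `h = q ξ − W_max ξ` is locally integrable. [folklore] -/
private theorem locallyIntegrable_h (ξ : (prolateMax lam).domain) :
    LocallyIntegrable (fun t ↦ qCoeff lam t * (ξ : L2R) t - (prolateMax lam ξ : L2R) t) := by
  have hu : LocallyIntegrable (fun t ↦ ((ξ : L2R) : ℝ → ℂ) t) :=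
    (Lp.memLp (ξ : L2R)).locallyIntegrable (by norm_num)
  have he : LocallyIntegrable (fun t ↦ ((prolateMax lam ξ : L2R) : ℝ → ℂ) t) :=
    (Lp.memLp (prolateMax lam ξ : L2R)).locallyIntegrable (by norm_num)
  have hq : Continuous (qCoeff lam) := by unfold qCoeff; fun_prop
  have hqu : LocallyIntegrable (fun t ↦ qCoeff lam t * (ξ : L2R) t) := by
    rw [← locallyIntegrableOn_univ] at hu ⊢
    exact hu.continuousOn_mul hq.continuousOn isClosed_univ.isLocallyClosed
  exact hqu.sub he

/-- Interval integrability of `h`. [folklore] -/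
private theorem intervalIntegrable_h (ξ : (prolateMax lam).domain) (x y : ℝ) :
    IntervalIntegrable (fun t ↦ qCoeff lam t * (ξ : L2R) t - (prolateMax lam ξ : L2R) t)
      volume x y :=
  (intervalIntegrable_iff').2 ((locallyIntegrable_h ξ).integrableOn_isCompact isCompact_uIcc)

/-- `F(x) = ∫_a^x h` is continuous. [folklore] -/
private theorem continuous_F (ξ : (prolateMax lam).domain) (a : ℝ) :
    Continuous fun x ↦ ∫ t in a..x,
      (qCoeff lam t * (ξ : L2R) t - (prolateMax lam ξ : L2R) t) :=
  intervalIntegral.continuous_primitive (intervalIntegrable_h ξ) a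

/-- RH-FREE (PROVED). **The weak first-order equation on the side interval** `J = (a, b₀)` (no zero of
`p` in `J`): with `h = qξ − W_max ξ`, `F(x) = ∫_a^x h`, a bump `φ₂` on `J` with `∫ φ₂ = 1` and the
constant `m = −∫ ξ (pφ₂)′ − ∫ φ₂ F`, every test function `Θ` on `J` satisfies
`∫ Θ′ ξ = −∫ Θ (F + m)/p` — i.e. `p ξ′ = F + m` in `𝒟′(J)` ("It follows that
`⟨ψ − f₁ | ∂φ⟩ = 0` … `⟨ψ | φ⟩ = ⟨f₁ + s | φ⟩`").
[cite: ConnesMoscovici2022, proof of Lemma 1.2 (= arXiv Lemma 2.2, chunk p0004:L64–L84)] -/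
theorem integral_deriv_mul_eq_of_mem_prolateMax (hab : a < b₀)
    (hpJ : ∀ x ∈ Ioo a b₀, lam ^ 2 - x ^ 2 ≠ 0) (ξ : (prolateMax lam).domain)
    {φ₂ : ℝ → ℝ} (hφ₂ : ContDiff ℝ ∞ φ₂) (hφ₂c : HasCompactSupport φ₂)
    (hφ₂s : tsupport φ₂ ⊆ Ioo a b₀) (hφ₂i : ∫ x, φ₂ x = 1)
    {Θ : ℝ → ℝ} (hΘ : ContDiff ℝ ∞ Θ) (hΘc : HasCompactSupport Θ) (hΘs : tsupport Θ ⊆ Ioo a b₀) :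
    ∫ x, ((deriv Θ x : ℝ) : ℂ) * (ξ : L2R) x =
      -∫ x, (Θ x : ℂ) *
        (((∫ t in a..x, (qCoeff lam t * (ξ : L2R) t - (prolateMax lam ξ : L2R) t)) +
          (-(∫ y, (ξ : L2R) y * ((deriv (fun z ↦ (lam ^ 2 - z ^ 2) * φ₂ z) y : ℝ) : ℂ)) -
            ∫ y, (φ₂ y : ℂ) *
              ∫ t in a..y, (qCoeff lam t * (ξ : L2R) t - (prolateMax lam ξ : L2R) t))) /
          ((lam ^ 2 - x ^ 2 : ℝ) : ℂ)) := by
  -- names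
  set u : ℝ → ℂ := fun t ↦ ((ξ : L2R) : ℝ → ℂ) t with hu
  set h : ℝ → ℂ := fun t ↦ qCoeff lam t * (ξ : L2R) t - (prolateMax lam ξ : L2R) t with hh
  set F : ℝ → ℂ := fun x ↦ ∫ t in a..x, h t with hF
  set pR : ℝ → ℝ := fun x ↦ lam ^ 2 - x ^ 2 with hpR
  have hpRs : ContDiff ℝ ∞ pR := by rw [hpR]; fun_prop
  have hpC : ∀ x, pCoeff lam x = ((pR x : ℝ) : ℂ) := fun x ↦ rfl
  set m : ℂ := -(∫ y, u y * ((deriv (fun z ↦ pR z * φ₂ z) y : ℝ) : ℂ)) -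
    ∫ y, (φ₂ y : ℂ) * F y with hm
  -- the test function `Θ₀ = Θ − c·pφ₂` with `∫ Θ₀/p = 0`, and its `p`-primitive `θ`
  set c : ℝ := ∫ x, Θ x / pR x with hc
  set Θ₀ : ℝ → ℝ := fun x ↦ Θ x - c * (pR x * φ₂ x) with hΘ₀
  have hΘ₀s : ContDiff ℝ ∞ Θ₀ := hΘ.sub (contDiff_const.mul (hpRs.mul hφ₂))
  have hΘ₀c : HasCompactSupport Θ₀ := hΘc.sub ((hφ₂c.mul_left).mul_left)
  have hΘ₀supp : tsupport Θ₀ ⊆ Ioo a b₀ :=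
    (tsupport_sub _ _).trans (union_subset hΘs
      ((tsupport_mul_subset_right).trans ((tsupport_mul_subset_right).trans hφ₂s)))
  set ψ : ℝ → ℝ := fun x ↦ Θ₀ x / pR x with hψ
  have hψs : ContDiff ℝ ∞ ψ := contDiff_div_of_tsupport hΘ₀s hpRs hΘ₀supp hpJ
  have hΘps : ContDiff ℝ ∞ (fun x ↦ Θ x / pR x) := contDiff_div_of_tsupport hΘ hpRs hΘs hpJ
  have hψ_eq : ∀ x, ψ x = Θ x / pR x - c * φ₂ x := by
    intro x
    simp only [hψ, hΘ₀]
    by_cases hx : pR x = 0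
    · have hxJ : x ∉ Ioo a b₀ := fun hxJ ↦ hpJ x hxJ hx
      have : φ₂ x = 0 := image_eq_zero_of_notMem_tsupport fun h' ↦ hxJ (hφ₂s h')
      rw [this, hx]; simp
    · field_simp
  have hψc : HasCompactSupport ψ := hΘ₀c.mono fun x hx ↦ by
    rw [Function.mem_support] at hx ⊢
    intro h0; exact hx (by simp [hψ, h0])
  have hψsupp : tsupport ψ ⊆ Ioo a b₀ := by
    refine (closure_mono fun x hx ↦ ?_).trans hΘ₀supp
    rw [Function.mem_support] at hx ⊢
    intro h0; exact hx (by simp [hψ, h0])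
  -- vanishing outside `J`
  have hΘ0 : ∀ x, x ∉ Ioo a b₀ → Θ x = 0 := fun x hx ↦
    image_eq_zero_of_notMem_tsupport fun h' ↦ hx (hΘs h')
  have hφ0 : ∀ x, x ∉ Ioo a b₀ → φ₂ x = 0 := fun x hx ↦
    image_eq_zero_of_notMem_tsupport fun h' ↦ hx (hφ₂s h')
  have hmul : ∀ y, pR y * ψ y = Θ₀ y := by
    intro y
    by_cases hy : pR y = 0
    · have hyJ : y ∉ Ioo a b₀ := fun hyJ ↦ hpJ y hyJ hy
      simp [hψ, hΘ₀, hy, hΘ0 y hyJ]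
    · simp only [hψ]; field_simp
  -- integrals of `ψ`
  have hΘpc : HasCompactSupport (fun x ↦ Θ x / pR x) := hΘc.mono fun x hx ↦ by
    rw [Function.mem_support] at hx ⊢
    intro h0; exact hx (by simp [h0])
  have hΘpi : Integrable (fun x ↦ Θ x / pR x) :=
    hΘps.continuous.integrable_of_hasCompactSupport hΘpc
  have hφ₂int : Integrable φ₂ := hφ₂.continuous.integrable_of_hasCompactSupport hφ₂c
  have hψi : ∫ x, ψ x = 0 := by
    rw [show ψ = fun x ↦ Θ x / pR x - c * φ₂ x from funext hψ_eq,
      integral_sub hΘpi (hφ₂int.const_mul c), integral_const_mul, hφ₂i, ← hc]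
    ring
  obtain ⟨hθs, hθc, hθsupp, hθd⟩ := primitive_test hab hψs hψc hψsupp hψi
  -- the complex test function `θℂ` as a Schwartz map
  have hθcC : HasCompactSupport (fun x ↦ ((∫ t in a..x, ψ t : ℝ) : ℂ)) :=
    hθc.comp_left Complex.ofReal_zero
  have hθsC : ContDiff ℝ ∞ (fun x ↦ ((∫ t in a..x, ψ t : ℝ) : ℂ)) :=
    (Complex.ofRealCLM.contDiff.of_le le_top).comp hθs
  set Φ : 𝓢(ℝ, ℂ) := hθcC.toSchwartzMap hθsC with hΦ
  have hΦ_apply : ∀ x, Φ x = ((∫ t in a..x, ψ t : ℝ) : ℂ) := fun x ↦ rfl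
  have hΦd : ∀ y, deriv (⇑Φ) y = ((ψ y : ℝ) : ℂ) := by
    intro y
    have h1 : HasDerivAt (fun x ↦ ∫ t in a..x, ψ t) (ψ y) y := by
      have := (hθs.differentiable (by simp) y).hasDerivAt
      rwa [hθd y] at this
    have h2 := h1.ofReal_comp
    exact h2.deriv
  have hpΦ : (fun y ↦ pCoeff lam y * deriv (⇑Φ) y) = fun y ↦ ((Θ₀ y : ℝ) : ℂ) := by
    funext y; rw [hpC, hΦd, ← Complex.ofReal_mul, hmul]
  -- derivatives of `Θ₀`
  have hpφd : ∀ x, HasDerivAt (fun z ↦ pR z * φ₂ z) (deriv (fun z ↦ pR z * φ₂ z) x) x := fun x ↦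
    (((hpRs.mul hφ₂).differentiable (by simp)) x).hasDerivAt
  have hΘd' : ∀ x, HasDerivAt Θ (deriv Θ x) x := fun x ↦
    ((hΘ.differentiable (by simp)) x).hasDerivAt
  have hΘ₀d : ∀ x, deriv Θ₀ x = deriv Θ x - c * deriv (fun z ↦ pR z * φ₂ z) x := fun x ↦
    ((hΘd' x).sub ((hpφd x).const_mul c)).deriv
  have hΘ₀dC : ∀ x, deriv (fun y ↦ ((Θ₀ y : ℝ) : ℂ)) x = ((deriv Θ₀ x : ℝ) : ℂ) := fun x ↦
    (((hΘ₀s.differentiable (by simp)) x).hasDerivAt.ofReal_comp).deriv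
  -- (E1): the weak equation tested against `Φ`
  have E1 := integral_mul_deriv_pCoeff_mul_deriv lam ξ Φ
  rw [hpΦ] at E1
  simp_rw [hΘ₀dC, hΘ₀d, hΦ_apply] at E1
  -- (E2): Fubini against the primitive
  have hhJ : IntegrableOn h (Ioo a b₀) :=
    (locallyIntegrable_h ξ).integrableOn_isCompact isCompact_Icc |>.mono_set Ioo_subset_Icc_self
  have E2 := integral_deriv_mul_primitive hab hhJ hθs hθc hθsupp
  simp_rw [hθd] at E2
  -- integrability of the pieces
  have hu_li : LocallyIntegrableOn u univ :=
    ((Lp.memLp (ξ : L2R)).locallyIntegrable (by norm_num)).locallyIntegrableOn _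
  have hI_Θ'u : Integrable (fun x ↦ ((deriv Θ x : ℝ) : ℂ) * u x) :=
    integrable_mul_of_tsupport_subset hu_li (hΘ.continuous_deriv (by simp)) hΘc.deriv (subset_univ _)
  have hI_pφ'u : Integrable (fun x ↦ ((deriv (fun z ↦ pR z * φ₂ z) x : ℝ) : ℂ) * u x) :=
    integrable_mul_of_tsupport_subset hu_li ((hpRs.mul hφ₂).continuous_deriv (by simp))
      (hφ₂c.mul_left).deriv (subset_univ _)
  have hFc : Continuous F := continuous_F ξ a
  have hF_li : LocallyIntegrableOn F univ := (hFc.locallyIntegrable).locallyIntegrableOn _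
  have hI_ΘpF : Integrable (fun x ↦ ((Θ x / pR x : ℝ) : ℂ) * F x) :=
    integrable_mul_of_tsupport_subset hF_li hΘps.continuous hΘpc (subset_univ _)
  have hI_φF : Integrable (fun x ↦ ((φ₂ x : ℝ) : ℂ) * F x) :=
    integrable_mul_of_tsupport_subset hF_li hφ₂.continuous hφ₂c (subset_univ _)
  have hI_Θp : Integrable (fun x ↦ ((Θ x / pR x : ℝ) : ℂ)) := hΘpi.ofReal
  -- rewrite (E1): `∫ u Θ' − c A = ∫ h θ`
  set A : ℂ := ∫ y, u y * ((deriv (fun z ↦ pR z * φ₂ z) y : ℝ) : ℂ) with hA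
  set B : ℂ := ∫ y, (φ₂ y : ℂ) * F y with hB
  have E1' : (∫ x, ((deriv Θ x : ℝ) : ℂ) * u x) - (c : ℂ) * A =
      ∫ x, h x * ((∫ t in a..x, ψ t : ℝ) : ℂ) := by
    rw [← E1]
    have e : (fun x ↦ u x * (((deriv Θ x - c * deriv (fun z ↦ pR z * φ₂ z) x : ℝ) : ℂ))) =
        fun x ↦ ((deriv Θ x : ℝ) : ℂ) * u x -
          (c : ℂ) * (((deriv (fun z ↦ pR z * φ₂ z) x : ℝ) : ℂ) * u x) := by
      funext x; push_cast; ring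
    have hA' : ∫ y, ((deriv (fun z ↦ pR z * φ₂ z) y : ℝ) : ℂ) * u y = A := by
      rw [hA]; congr 1; funext y; ring
    rw [show (fun x ↦ (ξ : L2R) x * (((deriv Θ x - c * deriv (fun z ↦ pR z * φ₂ z) x : ℝ) : ℂ)))
      = fun x ↦ u x * (((deriv Θ x - c * deriv (fun z ↦ pR z * φ₂ z) x : ℝ) : ℂ)) from rfl, e,
      integral_sub hI_Θ'u (hI_pφ'u.const_mul _), integral_const_mul, hA']
  -- rewrite (E2): `∫ ψ F = −∫ θ h`, and expand `ψ`
  have E2' : ∫ x, h x * ((∫ t in a..x, ψ t : ℝ) : ℂ) =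
      -((∫ x, ((Θ x / pR x : ℝ) : ℂ) * F x) - (c : ℂ) * B) := by
    have e : ∫ x, ((∫ t in a..x, ψ t : ℝ) : ℂ) * h x = ∫ x, h x * ((∫ t in a..x, ψ t : ℝ) : ℂ) := by
      congr 1; funext x; ring
    rw [← e, ← neg_eq_iff_eq_neg.mpr E2]  -- `∫ θ h = -∫ ψ F`
    congr 1
    have e2 : (fun x ↦ ((ψ x : ℝ) : ℂ) * F x) =
        fun x ↦ ((Θ x / pR x : ℝ) : ℂ) * F x - (c : ℂ) * (((φ₂ x : ℝ) : ℂ) * F x) := by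
      funext x; rw [hψ_eq]; push_cast; ring
    rw [show (fun x ↦ ((ψ x : ℝ) : ℂ) * ∫ t in a..x, h t) = fun x ↦ ((ψ x : ℝ) : ℂ) * F x from rfl,
      e2, integral_sub hI_ΘpF (hI_φF.const_mul _), integral_const_mul]
  -- the right-hand side of the goal
  have hc' : ∫ x, ((Θ x / pR x : ℝ) : ℂ) = (c : ℂ) := by
    rw [integral_complex_ofReal, ← hc]
  have epw : (fun x ↦ (Θ x : ℂ) * ((F x + m) / ((pR x : ℝ) : ℂ))) =
      fun x ↦ ((Θ x / pR x : ℝ) : ℂ) * F x + ((Θ x / pR x : ℝ) : ℂ) * m := by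
    funext x
    by_cases hx : pR x = 0
    · have hxJ : x ∉ Ioo a b₀ := fun hxJ ↦ hpJ x hxJ hx
      simp [hΘ0 x hxJ]
    · have hxC : ((pR x : ℝ) : ℂ) ≠ 0 := by exact_mod_cast hx
      push_cast
      field_simp
  have hR : ∫ x, (Θ x : ℂ) * ((F x + m) / ((pR x : ℝ) : ℂ)) =
      (∫ x, ((Θ x / pR x : ℝ) : ℂ) * F x) + (c : ℂ) * m := by
    rw [epw, integral_add hI_ΘpF (hI_Θp.mul_const m), integral_mul_const, hc']
  -- assemble
  show ∫ x, ((deriv Θ x : ℝ) : ℂ) * u x = -∫ x, (Θ x : ℂ) * ((F x + m) / ((pR x : ℝ) : ℂ))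
  rw [hR]
  have := E1'.trans E2'
  rw [hm]
  linear_combination this

/-- RH-FREE (PROVED). **Regularity and the boundary value.** In the setting of
`integral_deriv_mul_eq_of_mem_prolateMax`, if `g` is an a.e. representative of `ξ` differentiable
off `{±λ} ⊇ J`-complement with `p g′ → c` at `a` (within `{x ≠ ±λ}`), then `c = m`: on `J`, `ξ`
agrees a.e. with a `C¹` function `ũ` with `p ũ′ = F + m` (du Bois-Reymond), `g = ũ` on `J` by
continuity, and `F(a) = 0` ("the distribution `p∂ξ` coincides with the function `f = f₁ + s`
on `V`. One has `f(a) = s + f₁(a)`").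
[cite: ConnesMoscovici2022, proof of Lemma 1.2 (= arXiv Lemma 2.2, chunk p0004:L80–L90)] -/
theorem limit_pCoeff_mul_deriv_eq (hab : a < b₀)
    (hpJ : ∀ x ∈ Ioo a b₀, lam ^ 2 - x ^ 2 ≠ 0)
    (hJU : Ioo a b₀ ⊆ {x | x ≠ lam ∧ x ≠ -lam}) (ξ : (prolateMax lam).domain)
    {φ₂ : ℝ → ℝ} (hφ₂ : ContDiff ℝ ∞ φ₂) (hφ₂c : HasCompactSupport φ₂)
    (hφ₂s : tsupport φ₂ ⊆ Ioo a b₀) (hφ₂i : ∫ x, φ₂ x = 1)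
    {g : ℝ → ℂ} (hg : ((ξ : L2R) : ℝ → ℂ) =ᵐ[volume] g)
    (hgd : DifferentiableOn ℝ g {x | x ≠ lam ∧ x ≠ -lam}) {c : ℂ}
    (hgc : Tendsto (fun x ↦ pCoeff lam x * deriv g x) (𝓝[{x | x ≠ lam ∧ x ≠ -lam}] a) (𝓝 c)) :
    c = -(∫ y, (ξ : L2R) y * ((deriv (fun z ↦ (lam ^ 2 - z ^ 2) * φ₂ z) y : ℝ) : ℂ)) -
          ∫ y, (φ₂ y : ℂ) *
            ∫ t in a..y, (qCoeff lam t * (ξ : L2R) t - (prolateMax lam ξ : L2R) t) := by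
  set u : ℝ → ℂ := fun t ↦ ((ξ : L2R) : ℝ → ℂ) t with hu
  set h : ℝ → ℂ := fun t ↦ qCoeff lam t * (ξ : L2R) t - (prolateMax lam ξ : L2R) t with hh
  set F : ℝ → ℂ := fun x ↦ ∫ t in a..x, h t with hF
  set pR : ℝ → ℝ := fun x ↦ lam ^ 2 - x ^ 2 with hpR
  set m : ℂ := -(∫ y, u y * ((deriv (fun z ↦ pR z * φ₂ z) y : ℝ) : ℂ)) -
    ∫ y, (φ₂ y : ℂ) * F y with hm
  set w : ℝ → ℂ := fun x ↦ (F x + m) / ((pR x : ℝ) : ℂ) with hw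
  have hFc : Continuous F := continuous_F ξ a
  have hpRc : Continuous pR := by rw [hpR]; fun_prop
  have hwc : ContinuousOn w (Ioo a b₀) := by
    refine (hFc.continuousOn.add continuousOn_const).div
      (Complex.continuous_ofReal.comp hpRc).continuousOn fun x hx ↦ ?_
    exact_mod_cast hpJ x hx
  have hx₁ : (a + b₀) / 2 ∈ Ioo a b₀ := ⟨by linarith, by linarith⟩
  have hu_li : LocallyIntegrableOn u (Ioo a b₀) :=
    ((Lp.memLp (ξ : L2R)).locallyIntegrable (by norm_num)).locallyIntegrableOn _
  -- du Bois-Reymond: `u = G + k` a.e. on `J`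
  obtain ⟨k, hk⟩ := ae_eq_primitive_add_const hab hu_li hwc hx₁ (fun Θ hΘ hΘc hΘs ↦
    integral_deriv_mul_eq_of_mem_prolateMax hab hpJ ξ hφ₂ hφ₂c hφ₂s hφ₂i hΘ hΘc hΘs)
  set G : ℝ → ℂ := fun x ↦ ∫ t in (a + b₀) / 2..x, w t with hG
  have hGd : ∀ x ∈ Ioo a b₀, HasDerivAt G (w x) x := by
    intro x hx
    have hsub : uIcc ((a + b₀) / 2) x ⊆ Ioo a b₀ := fun y hy ↦
      ⟨lt_of_lt_of_le (lt_min hx₁.1 hx.1) hy.1, lt_of_le_of_lt hy.2 (max_lt hx₁.2 hx.2)⟩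
    exact intervalIntegral.integral_hasDerivAt_right ((hwc.mono hsub).intervalIntegrable)
      (hwc.stronglyMeasurableAtFilter isOpen_Ioo x hx) (hwc.continuousAt (isOpen_Ioo.mem_nhds hx))
  -- `g = G + k` on `J`
  have hgJ : EqOn g (fun x ↦ G x + k) (Ioo a b₀) := by
    refine Measure.eqOn_open_of_ae_eq (μ := volume) ?_ isOpen_Ioo (hgd.continuousOn.mono hJU)
      (fun x hx ↦ ((hGd x hx).continuousAt.add continuousAt_const).continuousWithinAt)
    rw [EventuallyEq, ae_restrict_iff' measurableSet_Ioo]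
    filter_upwards [hg, hk] with x h1 h2 hx
    rw [← h1]
    exact h2 hx
  have hderiv : ∀ x ∈ Ioo a b₀, pCoeff lam x * deriv g x = F x + m := by
    intro x hx
    have e : g =ᶠ[𝓝 x] fun y ↦ G y + k := hgJ.eventuallyEq_of_mem (isOpen_Ioo.mem_nhds hx)
    rw [e.deriv_eq, ((hGd x hx).add_const k).deriv, hw]
    have hpx : ((pR x : ℝ) : ℂ) ≠ 0 := by exact_mod_cast hpJ x hx
    rw [show pCoeff lam x = ((pR x : ℝ) : ℂ) from rfl]
    field_simp
  -- limits along `𝓝[J] a`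
  have hJa : (𝓝[Ioo a b₀] a).NeBot := by
    refine mem_closure_iff_nhdsWithin_neBot.mp ?_
    rw [closure_Ioo hab.ne]
    exact left_mem_Icc.mpr hab.le
  have hlim1 : Tendsto (fun x ↦ pCoeff lam x * deriv g x) (𝓝[Ioo a b₀] a) (𝓝 c) :=
    hgc.mono_left (nhdsWithin_mono a hJU)
  have hFa : F a = 0 := by simp [hF]
  have hlim2 : Tendsto (fun x ↦ pCoeff lam x * deriv g x) (𝓝[Ioo a b₀] a) (𝓝 m) := by
    have hFm : Tendsto (fun x ↦ F x + m) (𝓝[Ioo a b₀] a) (𝓝 m) := by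
      have := ((hFc.tendsto a).add (tendsto_const_nhds (x := m))).mono_left
        (nhdsWithin_le_nhds (s := Ioo a b₀))
      rwa [hFa, zero_add] at this
    exact hFm.congr' (eventually_nhdsWithin_of_forall fun x hx ↦ (hderiv x hx).symm)
  exact tendsto_nhds_unique hlim1 hlim2

end SideInterval

/-! ## §5. `W_min ⊂ W_max`, and the boundary functional as a pairing with two `L²` vectors -/

section Functional

/-- RH-FREE (PROVED). **`W` is symmetric on the Schwartz core**: `⟪Wψ, φ⟫ = ⟪ψ, Wφ⟫` ("As such,
`W` is real, symmetric"). [cite: ConnesMoscovici2022, §1 ¶1 (= arXiv §2 ¶1, chunk p0004:L14)] -/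
theorem prolateCore_symmetric (lam : ℝ) (x y : (prolateCore lam).domain) :
    ⟪prolateCore lam x, (y : L2R)⟫_ℂ = ⟪(x : L2R), prolateCore lam y⟫_ℂ := by
  obtain ⟨ψ, hψ⟩ := LinearMap.mem_range.mp x.2
  obtain ⟨φ, hφ⟩ := LinearMap.mem_range.mp y.2
  have hx : x = ⟨schwartzToL2 ψ, LinearMap.mem_range_self _ ψ⟩ := Subtype.ext hψ.symm
  have hy : y = ⟨schwartzToL2 φ, LinearMap.mem_range_self _ φ⟩ := Subtype.ext hφ.symm
  subst hx hy
  rw [prolateCore_apply, prolateCore_apply]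
  change ⟪((prolateSchwartz lam ψ).toLp 2 volume : L2R), (φ.toLp 2 volume : L2R)⟫_ℂ =
    ⟪(ψ.toLp 2 volume : L2R), ((prolateSchwartz lam φ).toLp 2 volume : L2R)⟫_ℂ
  rw [L2.inner_def, L2.inner_def]
  -- as integrals against the conjugate Schwartz function `ψ̄`
  set ψc : 𝓢(ℝ, ℂ) := SchwartzMap.postcompCLM (Complex.conjCLE : ℂ →L[ℝ] ℂ) ψ with hψc
  have hψc_apply : (⇑ψc : ℝ → ℂ) = fun t ↦ star (ψ t) := funext fun _ ↦ rfl
  have h1 : ∫ t, ⟪((prolateSchwartz lam ψ).toLp 2 volume : L2R) t, (φ.toLp 2 volume : L2R) t⟫_ℂ =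
      ∫ t, φ t * prolateSchwartz lam ψc t := by
    refine integral_congr_ae ?_
    filter_upwards [(prolateSchwartz lam ψ).coeFn_toLp 2 volume, φ.coeFn_toLp 2 volume] with t h1 h2
    rw [h1, h2, prolateSchwartz_apply lam ψc, hψc_apply, prolateWaveOpFun_star, ← prolateSchwartz_apply]
    simp
  have h2 : ∫ t, ⟪(ψ.toLp 2 volume : L2R) t, ((prolateSchwartz lam φ).toLp 2 volume : L2R) t⟫_ℂ =
      ∫ t, prolateSchwartz lam φ t * ψc t := by
    refine integral_congr_ae ?_
    filter_upwards [(prolateSchwartz lam φ).coeFn_toLp 2 volume, ψ.coeFn_toLp 2 volume] with t h1 h2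
    rw [h1, h2, hψc_apply]
    simp
  rw [h1, h2]
  -- twice the Schwartz integration by parts
  simp_rw [prolateSchwartz_apply', deriv_pCoeff_mul_deriv_eq]
  have eP : ∀ (f : 𝓢(ℝ, ℂ)) (t : ℝ), smulLeftCLM ℂ (pCoeff lam) f t = pCoeff lam t * f t :=
    fun f t ↦ by rw [smulLeftCLM_apply_apply (pCoeff_hasTemperateGrowth lam), smul_eq_mul]
  have key : ∫ t, φ t * derivCLM ℂ ℂ (smulLeftCLM ℂ (pCoeff lam) (derivCLM ℂ ℂ ψc)) t =
      ∫ t, derivCLM ℂ ℂ (smulLeftCLM ℂ (pCoeff lam) (derivCLM ℂ ℂ φ)) t * ψc t := by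
    have s1 := SchwartzMap.integral_mul_deriv_eq_neg_deriv_mul φ
      (smulLeftCLM ℂ (pCoeff lam) (derivCLM ℂ ℂ ψc))
    have s2 := SchwartzMap.integral_mul_deriv_eq_neg_deriv_mul
      (smulLeftCLM ℂ (pCoeff lam) (derivCLM ℂ ℂ φ)) ψc
    simp_rw [derivCLM_apply]
    rw [s1]
    have e : (fun t ↦ deriv (⇑φ) t * (smulLeftCLM ℂ (pCoeff lam) (derivCLM ℂ ℂ ψc)) t) =
        fun t ↦ (smulLeftCLM ℂ (pCoeff lam) (derivCLM ℂ ℂ φ)) t * deriv (⇑ψc) t := by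
      funext t; rw [eP, eP, derivCLM_apply, derivCLM_apply]; ring
    rw [e, s2, neg_neg]
  have hi : ∀ f g : 𝓢(ℝ, ℂ), Integrable (fun t ↦ f t * g t) := fun f g ↦
    integrable_schwartz_mul_Lp f (g.toLp 2 volume) |>.congr (by
      filter_upwards [g.coeFn_toLp 2 volume] with t ht; rw [ht])
  have eq1 : (fun t ↦ φ t * (-(derivCLM ℂ ℂ (smulLeftCLM ℂ (pCoeff lam) (derivCLM ℂ ℂ ψc))) t +
      qCoeff lam t * ψc t)) = fun t ↦ -(φ t * derivCLM ℂ ℂ (smulLeftCLM ℂ (pCoeff lam)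
        (derivCLM ℂ ℂ ψc)) t) + φ t * (smulLeftCLM ℂ (qCoeff lam) ψc) t := by
    funext t; rw [smulLeftCLM_apply_apply (qCoeff_hasTemperateGrowth lam), smul_eq_mul]; ring
  have eq2 : (fun t ↦ (-(derivCLM ℂ ℂ (smulLeftCLM ℂ (pCoeff lam) (derivCLM ℂ ℂ φ))) t +
      qCoeff lam t * φ t) * ψc t) = fun t ↦ -(derivCLM ℂ ℂ (smulLeftCLM ℂ (pCoeff lam)
        (derivCLM ℂ ℂ φ)) t * ψc t) + φ t * (smulLeftCLM ℂ (qCoeff lam) ψc) t := by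
    funext t; rw [smulLeftCLM_apply_apply (qCoeff_hasTemperateGrowth lam), smul_eq_mul]; ring
  have hn1 : Integrable (fun t ↦ -(φ t * derivCLM ℂ ℂ (smulLeftCLM ℂ (pCoeff lam)
      (derivCLM ℂ ℂ ψc)) t)) := (hi _ _).neg
  have hn2 : Integrable (fun t ↦ -(derivCLM ℂ ℂ (smulLeftCLM ℂ (pCoeff lam)
      (derivCLM ℂ ℂ φ)) t * ψc t)) := (hi _ _).neg
  rw [eq1, eq2, integral_add hn1 (hi _ _), integral_add hn2 (hi _ _), integral_neg, integral_neg,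
    key]

/-- RH-FREE (PROVED). **`W_min ⊂ W_max`** (the closure of a symmetric densely defined operator is
a restriction of its adjoint). [cite: ConnesMoscovici2022, §1 ¶1 (= arXiv §2 ¶1, chunk p0004:L15–L22)] -/
theorem prolateMin_le_prolateMax (lam : ℝ) : prolateMin lam ≤ prolateMax lam := by
  have hT := dense_schwartzL2
  have h1 : prolateCore lam ≤ prolateMax lam :=
    LinearPMap.IsFormalAdjoint.le_adjoint (T := prolateCore lam) hT (prolateCore_symmetric lam)
  have hclosed : (prolateMax lam).IsClosed := LinearPMap.adjoint_isClosed hT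
  have h2 : (prolateCore lam).closure ≤ (prolateMax lam).closure :=
    hclosed.isClosable.closure_mono h1
  have h3 : (prolateMax lam).closure ≤ prolateMax lam := by
    refine LinearPMap.le_of_le_graph (le_of_eq ?_)
    rw [← hclosed.isClosable.graph_closure_eq_closure_graph]
    exact IsClosed.submodule_topologicalClosure_eq hclosed
  exact h2.trans h3

end Functional

section Vectors

variable {lam a b₀ : ℝ} {φ₂ : ℝ → ℝ}

/-- A bounded Borel function vanishing off `(a, b₀]` is square integrable. [folklore] -/
private theorem memLp_two_of_bound_Ioc (a b₀ : ℝ) {f : ℝ → ℂ} (hf : AEStronglyMeasurable f volume)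
    {C : ℝ} (hC : 0 ≤ C) (hb : ∀ t ∈ Ioc a b₀, ‖f t‖ ≤ C) (h0 : ∀ t, t ∉ Ioc a b₀ → f t = 0) :
    MemLp f 2 volume := by
  have hs : MeasurableSet (Ioc a b₀) := measurableSet_Ioc
  refine MemLp.of_le (memLp_indicator_const 2 hs (C : ℂ) (Or.inr measure_Ioc_lt_top.ne)) hf
    (Eventually.of_forall fun t ↦ ?_)
  by_cases ht : t ∈ Ioc a b₀
  · rw [indicator_of_mem ht, Complex.norm_real, Real.norm_eq_abs, abs_of_nonneg hC]; exact hb t ht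
  · rw [h0 t ht, indicator_of_notMem ht, norm_zero]

/-- `t ↦ ∫_t^{b₀} φ₂` is continuous. [folklore] -/
private theorem continuous_tail (hφ₂ : ContDiff ℝ ∞ φ₂) (b₀ : ℝ) :
    Continuous fun t ↦ ((∫ x in t..b₀, φ₂ x : ℝ) : ℂ) := by
  refine Complex.continuous_ofReal.comp ?_
  have h := intervalIntegral.continuous_primitive (μ := volume)
    (fun x y ↦ hφ₂.continuous.intervalIntegrable x y) b₀
  have h' : Continuous fun t ↦ -∫ x in b₀..t, φ₂ x := h.neg
  simpa only [intervalIntegral.integral_symm b₀] using h'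

/-- The function `Ψ(t) = 1_{(a,b₀]}(t) ∫_t^{b₀} φ₂` is in `L²`. [folklore] -/
private theorem memLp_Psi (a b₀ : ℝ) (hφ₂ : ContDiff ℝ ∞ φ₂) :
    MemLp (fun t ↦ (Ioc a b₀).indicator (fun t ↦ ((∫ x in t..b₀, φ₂ x : ℝ) : ℂ)) t) 2 volume := by
  have hcont := continuous_tail hφ₂ b₀
  obtain ⟨C, hC⟩ := isCompact_Icc.exists_bound_of_continuousOn (hcont.continuousOn (s := Icc a b₀))
  refine memLp_two_of_bound_Ioc a b₀ (hcont.aestronglyMeasurable.indicator measurableSet_Ioc)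
    (le_max_right C 0) (fun t ht ↦ ?_) (fun t ht ↦ ?_)
  · rw [indicator_of_mem ht]; exact (hC t (Ioc_subset_Icc_self ht)).trans (le_max_left _ _)
  · rw [indicator_of_notMem ht]

/-- The function `q·Ψ` is in `L²`. [folklore] -/
private theorem memLp_q_mul_Psi (a b₀ : ℝ) (hφ₂ : ContDiff ℝ ∞ φ₂) (lam : ℝ) :
    MemLp (fun t ↦ qCoeff lam t *
      (Ioc a b₀).indicator (fun t ↦ ((∫ x in t..b₀, φ₂ x : ℝ) : ℂ)) t) 2 volume := by
  have hcont := continuous_tail hφ₂ b₀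
  have hq : Continuous (qCoeff lam) := by unfold qCoeff; fun_prop
  obtain ⟨C, hC⟩ := isCompact_Icc.exists_bound_of_continuousOn
    ((hq.mul hcont).continuousOn (s := Icc a b₀))
  refine memLp_two_of_bound_Ioc a b₀
    (hq.aestronglyMeasurable.mul (hcont.aestronglyMeasurable.indicator measurableSet_Ioc))
    (le_max_right C 0) (fun t ht ↦ ?_) (fun t ht ↦ ?_)
  · rw [indicator_of_mem ht]; exact (hC t (Ioc_subset_Icc_self ht)).trans (le_max_left _ _)
  · rw [indicator_of_notMem ht, mul_zero]

/-- The vector `g₁ = −(pφ₂)′ − qΨ` is in `L²`. [folklore] -/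
private theorem memLp_g₁ (a b₀ : ℝ) (hφ₂ : ContDiff ℝ ∞ φ₂) (hφ₂c : HasCompactSupport φ₂)
    (lam : ℝ) :
    MemLp (fun t ↦ -((deriv (fun z ↦ (lam ^ 2 - z ^ 2) * φ₂ z) t : ℝ) : ℂ) -
      qCoeff lam t * (Ioc a b₀).indicator (fun t ↦ ((∫ x in t..b₀, φ₂ x : ℝ) : ℂ)) t) 2 volume := by
  have hpRs : ContDiff ℝ ∞ (fun z : ℝ ↦ (lam ^ 2 - z ^ 2) * φ₂ z) := by fun_prop
  have h1 : MemLp (fun t ↦ ((deriv (fun z ↦ (lam ^ 2 - z ^ 2) * φ₂ z) t : ℝ) : ℂ)) 2 volume :=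
    (Complex.continuous_ofReal.comp (hpRs.continuous_deriv (by simp))).memLp_of_hasCompactSupport
      ((hφ₂c.mul_left).deriv.comp_left Complex.ofReal_zero)
  exact h1.neg.sub (memLp_q_mul_Psi a b₀ hφ₂ lam)

/-- RH-FREE (PROVED). **The boundary functional as an `L²` pairing**: for `ξ ∈ dom W_max`,
`⟪g₁, ξ⟫ + ⟪Ψ, W_max ξ⟫ = −∫ ξ (pφ₂)′ − ∫ φ₂ F` (`F(x) = ∫_a^x (qξ − W_max ξ)`), by the bump
Fubini identity — this exhibits the boundary functional as `⟨ξ | η₂⟩ + ⟨η | η₃⟩` "where the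
vectors `η_j ∈ L²(ℝ)`. Thus the linear form `L(ξ) := f(a)` is continuous in the graph norm of
`dom W_max`". [cite: ConnesMoscovici2022, proof of Lemma 1.2 (= arXiv Lemma 2.2, chunk p0004:L88–L100)] -/
theorem inner_vectors_eq_m (hab : a < b₀) (ξ : (prolateMax lam).domain)
    (hφ₂ : ContDiff ℝ ∞ φ₂) (hφ₂c : HasCompactSupport φ₂) (hφ₂s : tsupport φ₂ ⊆ Ioo a b₀) :
    ⟪((memLp_g₁ a b₀ hφ₂ hφ₂c lam).toLp _ : L2R), (ξ : L2R)⟫_ℂ +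
      ⟪((memLp_Psi a b₀ hφ₂).toLp _ : L2R), (prolateMax lam ξ : L2R)⟫_ℂ =
      -(∫ y, (ξ : L2R) y * ((deriv (fun z ↦ (lam ^ 2 - z ^ 2) * φ₂ z) y : ℝ) : ℂ)) -
        ∫ y, (φ₂ y : ℂ) *
          ∫ t in a..y, (qCoeff lam t * (ξ : L2R) t - (prolateMax lam ξ : L2R) t) := by
  set u : ℝ → ℂ := fun t ↦ ((ξ : L2R) : ℝ → ℂ) t with hu
  set e : ℝ → ℂ := fun t ↦ ((prolateMax lam ξ : L2R) : ℝ → ℂ) t with he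
  set h : ℝ → ℂ := fun t ↦ qCoeff lam t * (ξ : L2R) t - (prolateMax lam ξ : L2R) t with hh
  set Ψ : ℝ → ℂ := fun t ↦ (Ioc a b₀).indicator (fun t ↦ ((∫ x in t..b₀, φ₂ x : ℝ) : ℂ)) t with hΨ
  set D₂ : ℝ → ℂ := fun t ↦ ((deriv (fun z ↦ (lam ^ 2 - z ^ 2) * φ₂ z) t : ℝ) : ℂ) with hD₂
  have hΨreal : ∀ t, (starRingEnd ℂ) (Ψ t) = Ψ t := by
    intro t; simp only [hΨ, indicator]; split_ifs <;> simp [Complex.conj_ofReal]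
  have hqreal : ∀ t, (starRingEnd ℂ) (qCoeff lam t) = qCoeff lam t := fun t ↦ by
    rw [qCoeff, Complex.conj_ofReal]
  have hg₁real : ∀ t, (starRingEnd ℂ) (-D₂ t - qCoeff lam t * Ψ t) = -D₂ t - qCoeff lam t * Ψ t := by
    intro t; rw [map_sub, map_neg, map_mul, hD₂, Complex.conj_ofReal, hqreal, hΨreal]
  -- the two inner products as integrals
  have h1 : ⟪((memLp_g₁ a b₀ hφ₂ hφ₂c lam).toLp _ : L2R), (ξ : L2R)⟫_ℂ =
      ∫ t, u t * (-D₂ t - qCoeff lam t * Ψ t) := by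
    rw [L2.inner_def]
    refine integral_congr_ae ?_
    filter_upwards [(memLp_g₁ a b₀ hφ₂ hφ₂c lam).coeFn_toLp] with t ht
    rw [ht]
    simp only [RCLike.inner_apply, hu]
    rw [hg₁real]
  have h2 : ⟪((memLp_Psi a b₀ hφ₂).toLp _ : L2R), (prolateMax lam ξ : L2R)⟫_ℂ =
      ∫ t, e t * Ψ t := by
    rw [L2.inner_def]
    refine integral_congr_ae ?_
    filter_upwards [(memLp_Psi a b₀ hφ₂).coeFn_toLp] with t ht
    rw [ht]
    simp only [RCLike.inner_apply, he]
    rw [hΨreal]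
  -- integrability
  have hu_li : LocallyIntegrableOn u univ :=
    ((Lp.memLp (ξ : L2R)).locallyIntegrable (by norm_num)).locallyIntegrableOn _
  have hpRs : ContDiff ℝ ∞ (fun z : ℝ ↦ (lam ^ 2 - z ^ 2) * φ₂ z) := by fun_prop
  have I1 : Integrable (fun t ↦ D₂ t * u t) :=
    integrable_mul_of_tsupport_subset hu_li (hpRs.continuous_deriv (by simp)) (hφ₂c.mul_left).deriv
      (subset_univ _)
  have I2 : Integrable (fun t ↦ u t * (qCoeff lam t * Ψ t)) :=
    (Lp.memLp (ξ : L2R)).integrable_mul (memLp_q_mul_Psi a b₀ hφ₂ lam)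
  have I3 : Integrable (fun t ↦ e t * Ψ t) :=
    (Lp.memLp (prolateMax lam ξ : L2R)).integrable_mul (memLp_Psi a b₀ hφ₂)
  -- Fubini against the bump
  have hhJ : IntegrableOn h (Ioo a b₀) :=
    (locallyIntegrable_h ξ).integrableOn_isCompact isCompact_Icc |>.mono_set Ioo_subset_Icc_self
  have hR3 := integral_bump_mul_primitive hab hhJ hφ₂ hφ₂c hφ₂s
  -- assemble
  rw [h1, h2, hR3]
  have e1 : (fun t ↦ u t * (-D₂ t - qCoeff lam t * Ψ t)) =
      fun t ↦ -(D₂ t * u t) - u t * (qCoeff lam t * Ψ t) := by funext t; ring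
  have e2 : (fun t ↦ Ψ t * h t) = fun t ↦ u t * (qCoeff lam t * Ψ t) - e t * Ψ t := by
    funext t; simp only [hh, hu, he]; ring
  have I1n : Integrable (fun t ↦ -(D₂ t * u t)) := I1.neg
  rw [e1, e2, integral_sub I1n I2, integral_sub I2 I3, integral_neg]
  have e3 : (fun y ↦ (ξ : L2R) y * ((deriv (fun z ↦ (lam ^ 2 - z ^ 2) * φ₂ z) y : ℝ) : ℂ)) =
      fun t ↦ D₂ t * u t := by funext t; simp only [hD₂, hu]; ring
  rw [e3]
  ring

end Vectors

section Vanishing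

variable {lam a b₀ : ℝ} {φ₂ : ℝ → ℝ}

/-- RH-FREE (PROVED). **The boundary functional kills the Schwartz core**: for Schwartz `φ`,
`⟪g₁, φ⟫ + ⟪Ψ, Wφ⟫ = p(a) φ′(a) = 0` when `p(a) = 0` ("For `ξ ∈ 𝒮(ℝ)` the distribution
`ψ = p(x)∂ₓξ(x)` is a function vanishing at `x = a` and thus `L(ξ) = 0`").
[cite: ConnesMoscovici2022, proof of Lemma 1.2 (= arXiv Lemma 2.2, chunk p0004:L100)] -/
theorem inner_vectors_core_eq_zero (hab : a < b₀) (hpa : lam ^ 2 - a ^ 2 = 0)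
    (hφ₂ : ContDiff ℝ ∞ φ₂) (hφ₂c : HasCompactSupport φ₂) (hφ₂s : tsupport φ₂ ⊆ Ioo a b₀)
    (φ : 𝓢(ℝ, ℂ)) :
    ⟪((memLp_g₁ a b₀ hφ₂ hφ₂c lam).toLp _ : L2R), (φ.toLp 2 volume : L2R)⟫_ℂ +
      ⟪((memLp_Psi a b₀ hφ₂).toLp _ : L2R), ((prolateSchwartz lam φ).toLp 2 volume : L2R)⟫_ℂ
        = 0 := by
  set Ψ : ℝ → ℂ := fun t ↦ (Ioc a b₀).indicator (fun t ↦ ((∫ x in t..b₀, φ₂ x : ℝ) : ℂ)) t with hΨ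
  set pRφ : ℝ → ℝ := fun z ↦ (lam ^ 2 - z ^ 2) * φ₂ z with hpRφ
  set D₂ : ℝ → ℂ := fun t ↦ ((deriv pRφ t : ℝ) : ℂ) with hD₂
  set S : 𝓢(ℝ, ℂ) := smulLeftCLM ℂ (pCoeff lam) (derivCLM ℂ ℂ φ) with hS
  set Dp : ℝ → ℂ := fun t ↦ deriv (fun y ↦ pCoeff lam y * deriv φ y) t with hDp
  have hSfun : (fun y ↦ pCoeff lam y * deriv φ y) = ⇑S := by
    funext y; rw [hS, smulLeftCLM_apply_apply (pCoeff_hasTemperateGrowth lam), derivCLM_apply,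
      smul_eq_mul]
  have hDpS : ∀ t, Dp t = derivCLM ℂ ℂ S t := fun t ↦ by rw [hDp, derivCLM_apply, hSfun]
  have hΨreal : ∀ t, (starRingEnd ℂ) (Ψ t) = Ψ t := by
    intro t; simp only [hΨ, indicator]; split_ifs <;> simp [Complex.conj_ofReal]
  have hqreal : ∀ t, (starRingEnd ℂ) (qCoeff lam t) = qCoeff lam t := fun t ↦ by
    rw [qCoeff, Complex.conj_ofReal]
  have hg₁real : ∀ t, (starRingEnd ℂ) (-D₂ t - qCoeff lam t * Ψ t) = -D₂ t - qCoeff lam t * Ψ t := by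
    intro t; rw [map_sub, map_neg, map_mul, hD₂, Complex.conj_ofReal, hqreal, hΨreal]
  -- inner products as integrals
  have h1 : ⟪((memLp_g₁ a b₀ hφ₂ hφ₂c lam).toLp _ : L2R), (φ.toLp 2 volume : L2R)⟫_ℂ =
      ∫ t, φ t * (-D₂ t - qCoeff lam t * Ψ t) := by
    rw [L2.inner_def]
    refine integral_congr_ae ?_
    filter_upwards [(memLp_g₁ a b₀ hφ₂ hφ₂c lam).coeFn_toLp, φ.coeFn_toLp 2 volume] with t ht ht'
    rw [ht, ht']
    simp only [RCLike.inner_apply]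
    rw [hg₁real]
  have h2 : ⟪((memLp_Psi a b₀ hφ₂).toLp _ : L2R), ((prolateSchwartz lam φ).toLp 2 volume : L2R)⟫_ℂ
      = ∫ t, (-Dp t + qCoeff lam t * φ t) * Ψ t := by
    rw [L2.inner_def]
    refine integral_congr_ae ?_
    filter_upwards [(memLp_Psi a b₀ hφ₂).coeFn_toLp, (prolateSchwartz lam φ).coeFn_toLp 2 volume]
      with t ht ht'
    rw [ht, ht', prolateSchwartz_apply']
    simp only [RCLike.inner_apply]
    rw [hΨreal]
  -- integrability
  have hpRφs : ContDiff ℝ ∞ pRφ := by rw [hpRφ]; fun_prop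
  have hpRφc : HasCompactSupport pRφ := hφ₂c.mul_left
  have hD₂cont : Continuous D₂ := Complex.continuous_ofReal.comp (hpRφs.continuous_deriv (by simp))
  have I1 : Integrable (fun t ↦ φ t * D₂ t) :=
    ((φ.continuous.mul hD₂cont).integrable_of_hasCompactSupport
      ((hpRφc.deriv.comp_left Complex.ofReal_zero).mul_left))
  have IqΨ : Integrable (fun t ↦ φ t * (qCoeff lam t * Ψ t)) :=
    (φ.memLp 2 volume).integrable_mul (memLp_q_mul_Psi a b₀ hφ₂ lam)
  have I3 : Integrable (fun t ↦ Dp t * Ψ t) := by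
    have : (fun t ↦ Dp t * Ψ t) = fun t ↦ derivCLM ℂ ℂ S t * Ψ t := funext fun t ↦ by rw [hDpS]
    rw [this]
    exact ((derivCLM ℂ ℂ S).memLp 2 volume).integrable_mul (memLp_Psi a b₀ hφ₂)
  -- (i) `∫ Ψ Dp = ∫ φ₂ p φ′` by the bump Fubini identity and the FTC (`p(a) = 0`)
  have hDpJ : IntegrableOn Dp (Ioo a b₀) := by
    have : Dp = ⇑(derivCLM ℂ ℂ S) := funext hDpS
    rw [this]; exact ((derivCLM ℂ ℂ S).integrable).integrableOn
  have hR3 := integral_bump_mul_primitive hab hDpJ hφ₂ hφ₂c hφ₂s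
  have hFTC : ∀ x, (∫ t in a..x, Dp t) = pCoeff lam x * deriv φ x := by
    intro x
    have hd : ∀ y, HasDerivAt (fun y ↦ pCoeff lam y * deriv φ y) (Dp y) y := fun y ↦ by
      rw [hSfun, hDpS, derivCLM_apply]; exact S.hasDerivAt y
    rw [intervalIntegral.integral_eq_sub_of_hasDerivAt (fun y _ ↦ hd y)
      ((by rw [funext hDpS]; exact (derivCLM ℂ ℂ S).continuous : Continuous Dp).intervalIntegrable
        _ _)]
    have : pCoeff lam a = 0 := by rw [pCoeff, hpa]; simp
    rw [this, zero_mul, sub_zero]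
  simp_rw [hFTC] at hR3
  -- (ii) `∫ φ D₂ = -∫ φ′ (pφ₂)` by parts on a frame of `supp φ₂`
  obtain ⟨A, B, hA, hAB, hB, hsP, hsP'⟩ := exists_frame hab hpRφs hpRφc
    ((tsupport_mul_subset_right).trans hφ₂s)
  have hparts := intervalIntegral.integral_mul_deriv_eq_deriv_mul (a := A) (b := B)
    (u := ⇑φ) (v := fun y ↦ ((pRφ y : ℝ) : ℂ)) (u' := deriv φ) (v' := D₂)
    (fun x _ ↦ φ.hasDerivAt x)
    (fun x _ ↦ ((hpRφs.differentiable (by simp)) x).hasDerivAt.ofReal_comp)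
    ((((derivCLM ℂ ℂ φ).continuous).congr (fun x ↦ derivCLM_apply ℂ φ x)).intervalIntegrable
      _ _)
    (hD₂cont.intervalIntegrable _ _)
  have hP0 : ∀ x, x ∉ Ioo A B → ((pRφ x : ℝ) : ℂ) = 0 := fun x hx ↦ by
    rw [show pRφ x = 0 from by
      by_contra hne; exact hx (hsP (Function.mem_support.mpr hne))]; simp
  rw [hP0 A (fun h' ↦ (lt_irrefl A) h'.1), hP0 B (fun h' ↦ (lt_irrefl B) h'.2), mul_zero,
    mul_zero, sub_zero, zero_sub] at hparts
  have eL : ∫ t, φ t * D₂ t = ∫ t in A..B, φ t * D₂ t := by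
    refine (intervalIntegral.integral_eq_integral_of_support_subset fun x hx ↦ ?_).symm
    rw [Function.mem_support] at hx
    have : deriv pRφ x ≠ 0 := fun h0 ↦ hx (by rw [hD₂]; simp [h0])
    exact Ioo_subset_Ioc_self (hsP' (Function.mem_support.mpr this))
  have eR : ∫ t, deriv φ t * ((pRφ t : ℝ) : ℂ) = ∫ t in A..B, deriv φ t * ((pRφ t : ℝ) : ℂ) := by
    refine (intervalIntegral.integral_eq_integral_of_support_subset fun x hx ↦ ?_).symm
    rw [Function.mem_support] at hx
    have : pRφ x ≠ 0 := fun h0 ↦ hx (by simp [h0])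
    exact Ioo_subset_Ioc_self (hsP (Function.mem_support.mpr this))
  have hii : ∫ t, φ t * D₂ t = -∫ t, (φ₂ t : ℂ) * (pCoeff lam t * deriv φ t) := by
    rw [eL, hparts, ← eR, neg_inj]
    refine integral_congr_ae (Eventually.of_forall fun t ↦ ?_)
    simp only
    rw [hpRφ, show pCoeff lam t = ((lam ^ 2 - t ^ 2 : ℝ) : ℂ) from rfl]
    push_cast; ring
  -- assemble
  rw [h1, h2]
  have e1 : (fun t ↦ φ t * (-D₂ t - qCoeff lam t * Ψ t)) =
      fun t ↦ -(φ t * D₂ t) - φ t * (qCoeff lam t * Ψ t) := by funext t; ring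
  have e2 : (fun t ↦ (-Dp t + qCoeff lam t * φ t) * Ψ t) =
      fun t ↦ -(Dp t * Ψ t) + φ t * (qCoeff lam t * Ψ t) := by funext t; ring
  have I1n : Integrable (fun t ↦ -(φ t * D₂ t)) := I1.neg
  have I3n : Integrable (fun t ↦ -(Dp t * Ψ t)) := I3.neg
  rw [e1, e2, integral_sub I1n IqΨ, integral_add I3n IqΨ, integral_neg, integral_neg, hii]
  have e3 : ∫ t, Dp t * Ψ t = ∫ t, Ψ t * Dp t := by congr 1; funext t; ring
  rw [e3, ← hR3]
  ring

/-- Graph of the closure inside the closure of the graph (re-proved; see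
`UVProlateSpectrumProofs`). [folklore] -/
private theorem graph_closure_subset' (T : L2R →ₗ.[ℂ] L2R) :
    (T.closure.graph : Set (L2R × L2R)) ⊆ _root_.closure (T.graph : Set (L2R × L2R)) := by
  by_cases hT : T.IsClosable
  · rw [← hT.graph_closure_eq_closure_graph, Submodule.topologicalClosure_coe]
  · rw [LinearPMap.closure_def' hT]; exact subset_closure

/-- RH-FREE (PROVED). **The boundary functional vanishes on `dom W_min`** ("By the density of
`𝒮(ℝ)` in `dom W_min` for the graph norm, it follows that `L` vanishes on the closed subspace
`dom W_min`"): a closed-condition argument on the graph of `W_min`, using `W_min ⊂ W_max`.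
[cite: ConnesMoscovici2022, proof of Lemma 1.2 (= arXiv Lemma 2.2, chunk p0004:L100)] -/
theorem inner_vectors_eq_zero_of_mem_prolateMin (hab : a < b₀) (hpa : lam ^ 2 - a ^ 2 = 0)
    (hφ₂ : ContDiff ℝ ∞ φ₂) (hφ₂c : HasCompactSupport φ₂) (hφ₂s : tsupport φ₂ ⊆ Ioo a b₀)
    (ξ : (prolateMax lam).domain) (hξ : (ξ : L2R) ∈ (prolateMin lam).domain) :
    ⟪((memLp_g₁ a b₀ hφ₂ hφ₂c lam).toLp _ : L2R), (ξ : L2R)⟫_ℂ +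
      ⟪((memLp_Psi a b₀ hφ₂).toLp _ : L2R), (prolateMax lam ξ : L2R)⟫_ℂ = 0 := by
  set v₁ : L2R := (memLp_g₁ a b₀ hφ₂ hφ₂c lam).toLp _ with hv₁
  set v₂ : L2R := (memLp_Psi a b₀ hφ₂).toLp _ with hv₂
  set S : Set (L2R × L2R) := {p | ⟪v₁, p.1⟫_ℂ + ⟪v₂, p.2⟫_ℂ = 0} with hSdef
  have hSc : _root_.IsClosed S :=
    isClosed_eq ((continuous_const.inner continuous_fst).add (continuous_const.inner continuous_snd))
      continuous_const
  have hgraph : ((prolateCore lam).graph : Set (L2R × L2R)) ⊆ S := by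
    intro q hq
    obtain ⟨x, hx1, hx2⟩ := ((prolateCore lam).mem_graph_iff).mp hq
    obtain ⟨φ, hφ⟩ := LinearMap.mem_range.mp x.2
    have hx : x = ⟨schwartzToL2 φ, LinearMap.mem_range_self _ φ⟩ := Subtype.ext hφ.symm
    subst hx
    rw [prolateCore_apply] at hx2
    show ⟪v₁, q.1⟫_ℂ + ⟪v₂, q.2⟫_ℂ = 0
    rw [← hx1, ← hx2]
    exact inner_vectors_core_eq_zero hab hpa hφ₂ hφ₂c hφ₂s φ
  have hmem : ((ξ : L2R), prolateMin lam ⟨ξ, hξ⟩) ∈ S :=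
    (hSc.closure_subset_iff.mpr hgraph)
      (graph_closure_subset' (prolateCore lam) ((prolateMin lam).mem_graph ⟨ξ, hξ⟩))
  have heq : prolateMax lam ξ = prolateMin lam ⟨ξ, hξ⟩ :=
    ((prolateMin_le_prolateMax lam).2 rfl).symm
  rw [heq]
  exact hmem

end Vanishing

/-! ## 6. The witness `χ · log|x − a| ∈ dom W_max` with `p ∂ → −2a ≠ 0` at `a`

"To see that `L ≠ 0`, note that any element of `Dom W_max` belongs locally to the Sobolev
space … One has `η₀ = log|x − λ| ∈ Dom W_max` and `L(η₀) ≠ 0`" — made explicit with a smooth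
cutoff `χ` equal to `1` near `a` (so that `W_max(χ log|x−a|)` is an honest `L²` function). -/

section Witness

variable {lam a : ℝ}

/-- `log² y ≤ 16 |y|^{-1/2}` for `|y| ≤ 1`. [folklore] -/
private theorem log_sq_le {y : ℝ} (hy : |y| ≤ 1) :
    Real.log y ^ 2 ≤ 16 * |y| ^ (-(1 / 2) : ℝ) := by
  by_cases h0 : y = 0
  · subst h0; simp
  have hpos : 0 < |y| := abs_pos.2 h0
  have h := Real.abs_log_mul_self_rpow_lt |y| (1 / 4) hpos hy (by norm_num)
  rw [Real.log_abs, abs_mul, abs_of_nonneg (Real.rpow_nonneg hpos.le _)] at h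
  set s : ℝ := |y| ^ (1 / 4 : ℝ) with hs
  have hs0 : 0 < s := Real.rpow_pos_of_pos hpos _
  have h1 : |Real.log y| < 4 / s := by
    rw [lt_div_iff₀ hs0]; linarith
  have h2 : Real.log y ^ 2 < (4 / s) ^ 2 := by
    rw [← sq_abs (Real.log y)]
    exact pow_lt_pow_left₀ h1 (abs_nonneg _) two_ne_zero
  have h3 : |y| ^ (-(1 / 2) : ℝ) = (s ^ 2)⁻¹ := by
    rw [hs, ← Real.rpow_natCast, ← Real.rpow_mul hpos.le, ← Real.rpow_neg hpos.le]
    norm_num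
  rw [h3]
  have : (4 / s) ^ 2 = 16 * (s ^ 2)⁻¹ := by field_simp; norm_num
  linarith [h2, this]

/-- `θ · log|x − a| ∈ L²` for `θ` continuous with support in `(a − 1, a + 1)`. [folklore] -/
private theorem memLp_mul_log {θ : ℝ → ℝ} (hθ : Continuous θ)
    (hθs : Function.support θ ⊆ Ioo (a - 1) (a + 1)) :
    MemLp (fun x ↦ ((θ x * Real.log (x - a) : ℝ) : ℂ)) 2 volume := by
  have hθc : HasCompactSupport θ :=
    HasCompactSupport.of_support_subset_isCompact isCompact_Icc (hθs.trans Ioo_subset_Icc_self)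
  obtain ⟨M, hM⟩ := hθ.bounded_above_of_compact_support hθc
  have hmeas : AEStronglyMeasurable (fun x ↦ ((θ x * Real.log (x - a) : ℝ) : ℂ)) volume := by
    refine (Complex.measurable_ofReal.comp ?_).aestronglyMeasurable
    exact hθ.measurable.mul (Real.measurable_log.comp (measurable_id.sub_const a))
  rw [memLp_two_iff_integrable_sq_norm hmeas]
  set r : ℝ := -(1 / 2) with hr
  have hr1 : -1 < r := by norm_num [hr]
  have hI1 : IntegrableOn (fun x ↦ |x - a| ^ r) (Ioc a (a + 1)) := by
    have h := (intervalIntegral.intervalIntegrable_rpow' hr1 (a := 0) (b := 1)).comp_sub_right a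
    rw [zero_add, add_comm] at h
    have h' := (intervalIntegrable_iff_integrableOn_Ioc_of_le (by linarith)).1 h
    exact h'.congr_fun (fun x hx ↦ by
      show (x - a) ^ r = |x - a| ^ r
      rw [abs_of_nonneg (sub_nonneg.2 hx.1.le)]) measurableSet_Ioc
  have hI2 : IntegrableOn (fun x ↦ |x - a| ^ r) (Ioc (a - 1) a) := by
    have h := (intervalIntegral.intervalIntegrable_rpow' hr1 (a := 0) (b := 1)).comp_sub_left a
    rw [sub_zero] at h
    have h' := intervalIntegrable_iff.1 h
    rw [uIoc_of_ge (by linarith)] at h'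
    exact h'.congr_fun (fun x hx ↦ by
      show (a - x) ^ r = |x - a| ^ r
      rw [abs_of_nonpos (sub_nonpos.2 hx.2), neg_sub]) measurableSet_Ioc
  have hI : IntegrableOn (fun x ↦ |x - a| ^ r) (Ioc (a - 1) (a + 1)) := by
    rw [← Ioc_union_Ioc_eq_Ioc (show a - 1 ≤ a by linarith) (show a ≤ a + 1 by linarith)]
    exact hI2.union hI1
  have hdom : Integrable (fun x ↦ (Ioc (a - 1) (a + 1)).indicator
      (fun x ↦ M ^ 2 * (16 * |x - a| ^ r)) x) :=
    IntegrableOn.integrable_indicator ((hI.const_mul 16).const_mul (M ^ 2)) measurableSet_Ioc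
  refine hdom.mono' (hmeas.norm.aemeasurable.pow_const 2).aestronglyMeasurable
    (Eventually.of_forall fun x ↦ ?_)
  rw [norm_pow, norm_norm]
  by_cases hx : θ x = 0
  · simp only [hx, zero_mul, Complex.ofReal_zero, norm_zero, ne_eq, OfNat.ofNat_ne_zero,
      not_false_eq_true, zero_pow]
    exact indicator_nonneg (fun y _ ↦ by positivity) x
  have hxI : x ∈ Ioo (a - 1) (a + 1) := hθs (Function.mem_support.2 hx)
  rw [indicator_of_mem (Ioo_subset_Ioc_self hxI), Complex.norm_real, Real.norm_eq_abs, sq_abs,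
    mul_pow]
  have hya : |x - a| ≤ 1 := by
    rw [abs_le]; constructor <;> linarith [hxI.1, hxI.2]
  have h1 : θ x ^ 2 ≤ M ^ 2 := by
    rw [← sq_abs (θ x)]
    have := hM x
    rw [Real.norm_eq_abs] at this
    exact pow_le_pow_left₀ (abs_nonneg _) this 2
  have h2 := log_sq_le hya
  have h3 : 0 ≤ |x - a| ^ r := Real.rpow_nonneg (abs_nonneg _) _
  calc θ x ^ 2 * Real.log (x - a) ^ 2 ≤ M ^ 2 * (16 * |x - a| ^ (-(1 / 2) : ℝ)) :=
        mul_le_mul h1 h2 (sq_nonneg _) (by positivity)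
    _ = M ^ 2 * (16 * |x - a| ^ r) := by rw [hr]

/-- Near the centre a bump equals `1`, so its derivative vanishes there. [folklore] -/
private theorem deriv_bump_eq_zero (χ : ContDiffBump a) {x : ℝ} (hx : x ∈ Metric.ball a χ.rIn) :
    deriv χ x = 0 := by
  have h : (χ : ℝ → ℝ) =ᶠ[𝓝 x] fun _ ↦ (1 : ℝ) :=
    (Metric.isOpen_ball.eventually_mem hx).mono fun y hy ↦
      χ.one_of_mem_closedBall (Metric.ball_subset_closedBall hy)
  rw [h.deriv_eq, deriv_const]

/-- `x ↦ χ′(x) log|x − a|` is smooth (the derivative of the bump vanishes near `a`).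
[folklore] -/
private theorem contDiff_deriv_bump_mul_log (χ : ContDiffBump a) :
    ContDiff ℝ ∞ (fun x ↦ deriv χ x * Real.log (x - a)) := by
  have hdχ : ContDiff ℝ ∞ (deriv χ) := (contDiff_infty_iff_deriv.1 χ.contDiff).2
  refine contDiff_iff_contDiffAt.2 fun x ↦ ?_
  by_cases hx : x = a
  · rw [hx]
    have h0 : (fun y ↦ deriv χ y * Real.log (y - a)) =ᶠ[𝓝 a] fun _ ↦ (0 : ℝ) :=
      (Metric.isOpen_ball.eventually_mem (Metric.mem_ball_self χ.rIn_pos)).mono fun y hy ↦ by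
        simp only [deriv_bump_eq_zero χ hy, zero_mul]
    exact (contDiffAt_const (c := (0 : ℝ))).congr_of_eventuallyEq h0
  · exact hdχ.contDiffAt.mul
      ((Real.contDiffAt_log.2 (sub_ne_zero.2 hx)).comp x (contDiffAt_id.sub contDiffAt_const))

/-- Derivative of `χ log|x − a|` off `a`. [folklore] -/
private theorem hasDerivAt_bump_mul_log (χ : ContDiffBump a) {x : ℝ} (hx : x ≠ a) :
    HasDerivAt (fun y ↦ ((χ y * Real.log (y - a) : ℝ) : ℂ))
      (((deriv χ x * Real.log (x - a) + χ x * (x - a)⁻¹ : ℝ)) : ℂ) x := by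
  have h1 : HasDerivAt (χ : ℝ → ℝ) (deriv χ x) x :=
    ((χ.contDiff (n := ⊤)).differentiable (by simp) x).hasDerivAt
  have h2 : HasDerivAt (fun y ↦ Real.log (y - a)) (x - a)⁻¹ x := by
    simpa using ((hasDerivAt_id x).sub_const a).log (sub_ne_zero.2 (by simpa using hx))
  exact (h1.mul h2).ofReal_comp

/-- `v₀ = p · (χ log|x − a|)′ = (λ² − x²) χ′ log|x−a| − (a + x) χ` is smooth. [folklore] -/
private theorem contDiff_v₀ (χ : ContDiffBump a) (lam : ℝ) :
    ContDiff ℝ ∞ (fun x ↦ (lam ^ 2 - x ^ 2) * (deriv χ x * Real.log (x - a)) - (a + x) * χ x) :=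
  ((contDiff_const.sub (contDiff_id.pow 2)).mul (contDiff_deriv_bump_mul_log χ)).sub
    ((contDiff_const.add contDiff_id).mul χ.contDiff)

/-- `p · (χ log|x − a|)′ = v₀` off `a`, using `p(x) = a² − x² = −(a + x)(x − a)`. [folklore] -/
private theorem pCoeff_mul_deriv_bump_mul_log (χ : ContDiffBump a) (ha2 : a ^ 2 = lam ^ 2) {x : ℝ}
    (hx : x ≠ a) :
    pCoeff lam x * (((deriv χ x * Real.log (x - a) + χ x * (x - a)⁻¹ : ℝ)) : ℂ) =
      (((lam ^ 2 - x ^ 2) * (deriv χ x * Real.log (x - a)) - (a + x) * χ x : ℝ) : ℂ) := by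
  rw [show pCoeff lam x = ((lam ^ 2 - x ^ 2 : ℝ) : ℂ) from rfl, ← Complex.ofReal_mul]
  congr 1
  have hxa : x - a ≠ 0 := sub_ne_zero.2 hx
  have hp : lam ^ 2 - x ^ 2 = -(a + x) * (x - a) := by rw [← ha2]; ring
  rw [hp]
  field_simp
  ring

/-- RH-FREE (PROVED). **The witness**: for `a = ±λ` the function `u₀ = χ · log|x − a|` (`χ` a
smooth bump equal to `1` near `a`, supported in `(a − ½, a + ½)`) is in `L²`, lies in
`dom W_max` (with `W_max u₀ = −v₀′ + q u₀`, `v₀ = p u₀′` smooth), is differentiable off `±λ`,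
and `p u₀′ → −2a ≠ 0` at `a` ("One has `η₀ = log|x − λ| ∈ Dom W_max` and `L(η₀) ≠ 0`").
[cite: ConnesMoscovici2022, proof of Lemma 1.2 (= arXiv Lemma 2.2, chunk p0004:L100–L104)] -/
theorem exists_boundary_witness (ha : a = lam ∨ a = -lam) :
    ∃ u₀ : ℝ → ℂ, ∃ hu₀ : MemLp u₀ 2 volume,
      hu₀.toLp u₀ ∈ (prolateMax lam).domain ∧
      DifferentiableOn ℝ u₀ {x | x ≠ lam ∧ x ≠ -lam} ∧
      Tendsto (fun x ↦ pCoeff lam x * deriv u₀ x) (𝓝[{x | x ≠ lam ∧ x ≠ -lam}] a)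
        (𝓝 (((-(2 * a) : ℝ) : ℂ))) := by
  have ha2 : a ^ 2 = lam ^ 2 := by
    rcases ha with h | h
    · rw [h]
    · rw [h]; ring
  have haU : ∀ x ∈ {x : ℝ | x ≠ lam ∧ x ≠ -lam}, x ≠ a := by
    rintro x ⟨h1, h2⟩
    rcases ha with h | h
    · rw [h]; exact h1
    · rw [h]; exact h2
  let χ : ContDiffBump a := ⟨1 / 4, 1 / 2, by norm_num, by norm_num⟩
  have hrOut : χ.rOut = 1 / 2 := rfl
  set K : Set ℝ := Metric.closedBall a (1 / 2) with hK
  have hKI : K ⊆ Ioo (a - 1) (a + 1) := by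
    intro x hx
    rw [hK, Metric.mem_closedBall, Real.dist_eq, abs_le] at hx
    constructor <;> linarith [hx.1, hx.2]
  have hKIoc : K ⊆ Ioc (a - 1) (a + 1) := hKI.trans Ioo_subset_Ioc_self
  -- supports of `χ`, `χ′`
  have htsuppχ : tsupport (χ : ℝ → ℝ) = K := by rw [χ.tsupport_eq, hrOut]
  have hsuppχ : Function.support (χ : ℝ → ℝ) ⊆ K :=
    (subset_tsupport _).trans htsuppχ.le
  have hχ0 : ∀ x, x ∉ K → χ x = 0 := fun x hx ↦
    Function.notMem_support.1 fun h ↦ hx (hsuppχ h)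
  have hdχ0 : ∀ x, x ∉ K → deriv χ x = 0 := fun x hx ↦
    Function.notMem_support.1 fun h ↦ hx (htsuppχ.le (support_deriv_subset h))
  have haK1 : a + 1 ∉ K := fun h ↦ by
    rw [hK, Metric.mem_closedBall, Real.dist_eq] at h; norm_num [abs_le] at h
  have haK2 : a - 1 ∉ K := fun h ↦ by
    rw [hK, Metric.mem_closedBall, Real.dist_eq] at h; norm_num [abs_le] at h
  -- the functions
  set u₀ : ℝ → ℂ := fun x ↦ ((χ x * Real.log (x - a) : ℝ) : ℂ) with hu₀
  set du₀R : ℝ → ℝ := fun x ↦ deriv χ x * Real.log (x - a) + χ x * (x - a)⁻¹ with hdu₀R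
  set v₀R : ℝ → ℝ := fun x ↦ (lam ^ 2 - x ^ 2) * (deriv χ x * Real.log (x - a)) - (a + x) * χ x
    with hv₀R
  set v₀ : ℝ → ℂ := fun x ↦ ((v₀R x : ℝ) : ℂ) with hv₀
  set e₀ : ℝ → ℂ := fun x ↦ -((deriv v₀R x : ℝ) : ℂ) + qCoeff lam x * u₀ x with he₀
  have hu₀0 : ∀ x, x ∉ K → u₀ x = 0 := fun x hx ↦ by simp only [hu₀, hχ0 x hx, zero_mul]; simp
  have hv₀s : ContDiff ℝ ∞ v₀R := contDiff_v₀ χ lam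
  have hv₀0 : ∀ x, x ∉ K → v₀R x = 0 := fun x hx ↦ by
    simp only [hv₀R, hχ0 x hx, hdχ0 x hx]; ring
  have hv₀supp : Function.support v₀R ⊆ K := fun x hx ↦ by
    by_contra h; exact hx (hv₀0 x h)
  have hv₀c : HasCompactSupport v₀R :=
    HasCompactSupport.of_support_subset_isCompact (isCompact_closedBall a (1 / 2)) hv₀supp
  have hv₀ts : tsupport v₀R ⊆ K := closure_minimal hv₀supp Metric.isClosed_closedBall
  have hdv₀0 : ∀ x, x ∉ K → deriv v₀R x = 0 := fun x hx ↦
    Function.notMem_support.1 fun h ↦ hx (hv₀ts (support_deriv_subset h))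
  have hdv₀c : Continuous (deriv v₀R) := hv₀s.continuous_deriv (by simp)
  -- `u₀`, `q u₀`, `e₀` are in `L²`
  have hu₀L : MemLp u₀ 2 volume := memLp_mul_log χ.continuous (hsuppχ.trans hKI)
  have hqu₀L : MemLp (fun x ↦ qCoeff lam x * u₀ x) 2 volume := by
    have e : (fun x ↦ qCoeff lam x * u₀ x) =
        fun x ↦ ((((2 * π * lam) ^ 2 * x ^ 2 * χ x) * Real.log (x - a) : ℝ) : ℂ) := by
      funext x; simp only [hu₀, qCoeff]; push_cast; ring
    rw [e]
    refine memLp_mul_log ((continuous_const.mul (continuous_id.pow 2)).mul χ.continuous) ?_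
    intro x hx
    refine hKI (hsuppχ fun h ↦ hx ?_)
    simp only [h, mul_zero]
  have he₀L : MemLp e₀ 2 volume :=
    ((Complex.continuous_ofReal.comp hdv₀c).memLp_of_hasCompactSupport
      (hv₀c.deriv.comp_left Complex.ofReal_zero)).neg.add hqu₀L
  -- derivative of `u₀` off `a`
  have hu₀d : ∀ x, x ≠ a → HasDerivAt u₀ ((du₀R x : ℝ) : ℂ) x := fun x hx ↦
    hasDerivAt_bump_mul_log χ hx
  have hφ'c : ∀ φ : 𝓢(ℝ, ℂ), Continuous (deriv φ) := fun φ ↦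
    ((derivCLM ℂ ℂ φ).continuous).congr fun x ↦ derivCLM_apply ℂ φ x
  -- the weak identity `∫ (Wφ) u₀ = ∫ φ e₀`
  have hweak : ∀ φ : 𝓢(ℝ, ℂ), ∫ t, prolateSchwartz lam φ t * u₀ t = ∫ t, φ t * e₀ t := by
    intro φ
    set S : 𝓢(ℝ, ℂ) := smulLeftCLM ℂ (pCoeff lam) (derivCLM ℂ ℂ φ) with hS
    have hSfun : ∀ y, S y = pCoeff lam y * deriv φ y := fun y ↦ by
      rw [hS, smulLeftCLM_apply_apply (pCoeff_hasTemperateGrowth lam), derivCLM_apply, smul_eq_mul]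
    set Dp : ℝ → ℂ := fun t ↦ derivCLM ℂ ℂ S t with hDp
    have hDp' : ∀ t, deriv (fun y ↦ pCoeff lam y * deriv φ y) t = Dp t := fun t ↦ by
      show _ = derivCLM ℂ ℂ S t
      rw [derivCLM_apply ℂ S t, show (fun y ↦ pCoeff lam y * deriv φ y) = ⇑S from
        funext fun y ↦ (hSfun y).symm]
    -- Step 1: `∫ (pφ′)′ u₀ + ∫ φ′ v₀ = 0` (FTC for `pφ′·u₀`, singular point `a` excluded)
    set f : ℝ → ℂ := fun t ↦ S t * u₀ t with hf
    set f' : ℝ → ℂ := fun t ↦ Dp t * u₀ t + deriv φ t * v₀ t with hf'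
    have hml : Continuous (fun t : ℝ ↦ (t - a) * Real.log (t - a)) :=
      Real.continuous_mul_log.comp (continuous_id.sub continuous_const)
    have hfe : f = fun t ↦ deriv φ t * (χ t : ℂ) *
        (((-(a + t)) * ((t - a) * Real.log (t - a)) : ℝ) : ℂ) := by
      funext t
      simp only [hf, hu₀, hSfun t, show pCoeff lam t = ((lam ^ 2 - t ^ 2 : ℝ) : ℂ) from rfl]
      have hp : lam ^ 2 - t ^ 2 = -(a + t) * (t - a) := by rw [← ha2]; ring
      rw [hp]; push_cast; ring
    have hfc : Continuous f := by
      rw [hfe]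
      exact ((hφ'c φ).mul (Complex.continuous_ofReal.comp χ.continuous)).mul
        (Complex.continuous_ofReal.comp (((continuous_const.add continuous_id).neg).mul hml))
    have hfd : ∀ x ∈ Ioo (a - 1) (a + 1) \ {a}, HasDerivAt f (f' x) x := by
      intro x hx
      have hxa : x ≠ a := hx.2
      have hS' : HasDerivAt (⇑S) (Dp x) x := by
        rw [show Dp x = deriv S x from derivCLM_apply ℂ S x]; exact S.hasDerivAt x
      have key : pCoeff lam x * ((du₀R x : ℝ) : ℂ) = v₀ x :=
        pCoeff_mul_deriv_bump_mul_log χ ha2 hxa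
      refine ((hS'.mul (hu₀d x hxa))).congr_deriv ?_
      rw [hSfun x]
      show Dp x * u₀ x + pCoeff lam x * deriv φ x * ((du₀R x : ℝ) : ℂ) =
        Dp x * u₀ x + deriv φ x * v₀ x
      rw [← key]
      ring
    have hI1 : Integrable (fun t ↦ Dp t * u₀ t) :=
      ((derivCLM ℂ ℂ S).memLp 2 volume).integrable_mul hu₀L
    have hI2 : Integrable (fun t ↦ deriv φ t * v₀ t) :=
      ((hφ'c φ).mul (Complex.continuous_ofReal.comp hv₀s.continuous)).integrable_of_hasCompactSupport
        ((hv₀c.comp_left Complex.ofReal_zero).mul_left)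
    have hI : Integrable f' := by rw [hf']; exact hI1.add hI2
    have hftc := integral_eq_of_hasDerivAt_off_countable_of_le f f' (by linarith : a - 1 ≤ a + 1)
      (countable_singleton a) hfc.continuousOn hfd (hI.intervalIntegrable)
    have hfB : f (a + 1) = 0 := by simp only [hf, hu₀0 _ haK1, mul_zero]
    have hfA : f (a - 1) = 0 := by simp only [hf, hu₀0 _ haK2, mul_zero]
    rw [hfB, hfA, sub_zero, intervalIntegral.integral_eq_integral_of_support_subset] at hftc
    swap
    · intro t ht
      refine hKIoc ?_
      by_contra h
      exact ht (by simp only [hf', hu₀0 t h, hv₀, hv₀0 t h, Complex.ofReal_zero, mul_zero, add_zero])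
    simp only [hf'] at hftc
    rw [integral_add hI1 hI2] at hftc
    -- Step 2: `∫ φ v₀′ = -∫ φ′ v₀` (by parts, `v₀` smooth with compact support)
    have hparts := intervalIntegral.integral_mul_deriv_eq_deriv_mul (a := a - 1) (b := a + 1)
      (u := ⇑φ) (v := v₀) (u' := deriv φ) (v' := fun t ↦ ((deriv v₀R t : ℝ) : ℂ))
      (fun x _ ↦ φ.hasDerivAt x)
      (fun x _ ↦ ((hv₀s.differentiable (by simp)) x).hasDerivAt.ofReal_comp)
      ((hφ'c φ).intervalIntegrable _ _)
      ((Complex.continuous_ofReal.comp hdv₀c).intervalIntegrable _ _)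
    have hvB : v₀ (a + 1) = 0 := by simp only [hv₀, hv₀0 _ haK1, Complex.ofReal_zero]
    have hvA : v₀ (a - 1) = 0 := by simp only [hv₀, hv₀0 _ haK2, Complex.ofReal_zero]
    rw [hvB, hvA, mul_zero, mul_zero, sub_zero, zero_sub,
      intervalIntegral.integral_eq_integral_of_support_subset,
      intervalIntegral.integral_eq_integral_of_support_subset] at hparts
    rotate_left
    · intro t ht
      refine hKIoc ?_
      by_contra h
      exact ht (by simp only [hv₀, hv₀0 t h, Complex.ofReal_zero, mul_zero])
    · intro t ht
      refine hKIoc ?_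
      by_contra h
      exact ht (by simp only [hdv₀0 t h, Complex.ofReal_zero, mul_zero])
    -- Step 3: combine
    have hI3 : Integrable (fun t ↦ φ t * (qCoeff lam t * u₀ t)) :=
      (φ.memLp 2 volume).integrable_mul hqu₀L
    have hI4 : Integrable (fun t ↦ φ t * ((deriv v₀R t : ℝ) : ℂ)) :=
      ((φ.continuous).mul (Complex.continuous_ofReal.comp hdv₀c)).integrable_of_hasCompactSupport
        ((hv₀c.deriv.comp_left Complex.ofReal_zero).mul_left)
    have eL : (fun t ↦ prolateSchwartz lam φ t * u₀ t) =
        fun t ↦ -(Dp t * u₀ t) + φ t * (qCoeff lam t * u₀ t) := by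
      funext t; rw [prolateSchwartz_apply', hDp']; ring
    have eR : (fun t ↦ φ t * e₀ t) =
        fun t ↦ -(φ t * ((deriv v₀R t : ℝ) : ℂ)) + φ t * (qCoeff lam t * u₀ t) := by
      funext t; simp only [he₀]; ring
    have hI1n : Integrable (fun t ↦ -(Dp t * u₀ t)) := hI1.neg
    have hI4n : Integrable (fun t ↦ -(φ t * ((deriv v₀R t : ℝ) : ℂ))) := hI4.neg
    rw [eL, eR, integral_add hI1n hI3, integral_add hI4n hI3, integral_neg, integral_neg,
      hparts]
    congr 1
    rw [neg_neg]
    linear_combination -hftc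
  -- membership in `dom W_max`
  have hreal_u : ∀ t, (starRingEnd ℂ) (u₀ t) = u₀ t := fun t ↦ by
    simp only [hu₀, Complex.conj_ofReal]
  have hreal_e : ∀ t, (starRingEnd ℂ) (e₀ t) = e₀ t := fun t ↦ by
    simp only [he₀, hu₀, qCoeff, map_add, map_neg, map_mul, Complex.conj_ofReal]
  have hmem : hu₀L.toLp u₀ ∈ (prolateMax lam).domain := by
    refine LinearPMap.mem_adjoint_domain_of_exists _ ⟨he₀L.toLp e₀, fun x ↦ ?_⟩
    obtain ⟨φ, hφ⟩ := LinearMap.mem_range.mp x.2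
    have hx : x = ⟨schwartzToL2 φ, LinearMap.mem_range_self _ φ⟩ := Subtype.ext hφ.symm
    subst hx
    rw [prolateCore_apply]
    change ⟪(he₀L.toLp e₀ : L2R), (φ.toLp 2 volume : L2R)⟫_ℂ =
      ⟪(hu₀L.toLp u₀ : L2R), ((prolateSchwartz lam φ).toLp 2 volume : L2R)⟫_ℂ
    rw [L2.inner_def, L2.inner_def]
    have h1 : ∫ t, ⟪(he₀L.toLp e₀ : L2R) t, (φ.toLp 2 volume : L2R) t⟫_ℂ = ∫ t, φ t * e₀ t := by
      refine integral_congr_ae ?_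
      filter_upwards [he₀L.coeFn_toLp, φ.coeFn_toLp 2 volume] with t ht ht'
      rw [ht, ht']
      simp only [RCLike.inner_apply]
      rw [hreal_e]
    have h2 : ∫ t, ⟪(hu₀L.toLp u₀ : L2R) t, ((prolateSchwartz lam φ).toLp 2 volume : L2R) t⟫_ℂ =
        ∫ t, prolateSchwartz lam φ t * u₀ t := by
      refine integral_congr_ae ?_
      filter_upwards [hu₀L.coeFn_toLp, (prolateSchwartz lam φ).coeFn_toLp 2 volume] with t ht ht'
      rw [ht, ht']
      simp only [RCLike.inner_apply]
      rw [hreal_u]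
    rw [h1, h2, hweak]
  refine ⟨u₀, hu₀L, hmem, fun x hx ↦ (hu₀d x (haU x hx)).differentiableAt.differentiableWithinAt,
    ?_⟩
  -- the limit `p u₀′ → −2a` along `𝓝[≠ ±λ] a`
  have hev : (fun x ↦ (((-(a + x)) : ℝ) : ℂ)) =ᶠ[𝓝[{x | x ≠ lam ∧ x ≠ -lam}] a]
      fun x ↦ pCoeff lam x * deriv u₀ x := by
    rw [EventuallyEq, eventually_nhdsWithin_iff]
    filter_upwards [Metric.isOpen_ball.mem_nhds (Metric.mem_ball_self χ.rIn_pos)] with x hx hxU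
    have hxa : x ≠ a := haU x hxU
    rw [(hu₀d x hxa).deriv, hdu₀R]
    simp only
    rw [pCoeff_mul_deriv_bump_mul_log χ ha2 hxa, deriv_bump_eq_zero χ hx,
      χ.one_of_mem_closedBall (Metric.ball_subset_closedBall hx)]
    push_cast; ring
  refine Tendsto.congr' hev ?_
  have hc : Continuous (fun x : ℝ ↦ (((-(a + x)) : ℝ) : ℂ)) :=
    Complex.continuous_ofReal.comp (continuous_const.add continuous_id).neg
  have := (hc.tendsto a).mono_left (nhdsWithin_le_nhds (s := {x | x ≠ lam ∧ x ≠ -lam}))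
  rw [show ((-(2 * a) : ℝ) : ℂ) = ((-(a + a) : ℝ) : ℂ) by rw [two_mul]]
  exact this

end Witness

/-! ## 7. Assembly: Lemma 1.2 -/

section Assembly

/-- RH-FREE (PROVED). **Connes–Moscovici 2022, Lemma 1.2** (= arXiv:2112.05500 Lemma 2.2): for
`λ > 0` and `a ∈ {λ, −λ}` there is a nonzero linear form `L` on `dom W_max`, continuous in the
graph norm, vanishing on `dom W_min`, with `L ξ = lim_{x → a} p(x) ∂ₓξ(x)` whenever `ξ` has a
representative differentiable off `±λ` for which this limit exists.  The tree's named fact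
`CM22_lemma_1_2` is hereby DISCHARGED.  Construction: `L ξ = ⟪g₁, ξ⟫ + ⟪Ψ, W_max ξ⟫` with the
explicit `L²` vectors of §5 (bump `φ₂` in the side interval `J = (a, a + λ/2)`): continuity is
Cauchy–Schwarz, vanishing on `dom W_min` is §5 (`p(a) = 0` + closed graph), the boundary-value
clause is §4 (`p ∂ξ = F + L ξ` a.e. on `J`, one-sided uniqueness of limits), and `L ≠ 0` by the
witness `χ log|x − a|` of §6 (`L = −2a ≠ 0`).
[cite: ConnesMoscovici2022, Lemma 1.2 (= arXiv:2112.05500v1 Lemma 2.2, chunk p0004:L50–L104)] -/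
theorem CM22_lemma_1_2_holds : CM22_lemma_1_2 := by
  intro lam hlam a ha
  have ha' : a = lam ∨ a = -lam := by
    simpa only [mem_insert_iff, mem_singleton_iff] using ha
  have ha2 : a ^ 2 = lam ^ 2 := by
    rcases ha' with h | h
    · rw [h]
    · rw [h]; ring
  have ha0 : a ≠ 0 := by
    rcases ha' with h | h
    · rw [h]; exact hlam.ne'
    · rw [h]; exact neg_ne_zero.2 hlam.ne'
  set b₀ : ℝ := a + lam / 2 with hb₀
  have hab : a < b₀ := by rw [hb₀]; linarith
  have hpJ : ∀ x ∈ Ioo a b₀, lam ^ 2 - x ^ 2 ≠ 0 := by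
    intro x hx h0
    have hx2 : (x - a) * (x + a) = 0 := by nlinarith [ha2]
    rcases mul_eq_zero.1 hx2 with h | h
    · exact absurd (sub_eq_zero.1 h) (ne_of_gt hx.1)
    · have hxa : x = -a := by linarith
      rcases ha' with h' | h'
      · rw [h'] at hxa hx; linarith [hx.1]
      · rw [h'] at hxa hx; rw [hb₀, h'] at hx; linarith [hx.2]
  have hJU : Ioo a b₀ ⊆ {x | x ≠ lam ∧ x ≠ -lam} := by
    intro x hx
    have h := hpJ x hx
    constructor
    · intro h'; apply h; rw [h']; ring
    · intro h'; apply h; rw [h']; ring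
  have hpa : lam ^ 2 - a ^ 2 = 0 := by rw [ha2]; ring
  obtain ⟨φ₂, hφ₂, hφ₂c, hφ₂s, hφ₂i⟩ := exists_smooth_bump hab
  set v₁ : L2R := (memLp_g₁ a b₀ hφ₂ hφ₂c lam).toLp _ with hv₁
  set v₂ : L2R := (memLp_Psi a b₀ hφ₂).toLp _ with hv₂
  set L : (prolateMax lam).domain →ₗ[ℂ] ℂ :=
    ((innerSL ℂ v₁ : L2R →L[ℂ] ℂ) : L2R →ₗ[ℂ] ℂ) ∘ₗ (prolateMax lam).domain.subtype +
      ((innerSL ℂ v₂ : L2R →L[ℂ] ℂ) : L2R →ₗ[ℂ] ℂ) ∘ₗ (prolateMax lam).toFun with hLdef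
  have hL : ∀ ξ : (prolateMax lam).domain,
      L ξ = ⟪v₁, (ξ : L2R)⟫_ℂ + ⟪v₂, (prolateMax lam ξ : L2R)⟫_ℂ := fun ξ ↦ by
    rw [hLdef]
    simp only [LinearMap.add_apply, LinearMap.coe_comp, Function.comp_apply,
      ContinuousLinearMap.coe_coe, innerSL_apply_apply, Submodule.coe_subtype,
      LinearPMap.toFun_eq_coe]
  -- clause (v): the boundary value
  have hbv : ∀ (ξ : (prolateMax lam).domain) (g : ℝ → ℂ) (c : ℂ),
      ((ξ : L2R) : ℝ → ℂ) =ᵐ[volume] g → DifferentiableOn ℝ g {x | x ≠ lam ∧ x ≠ -lam} →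
      Tendsto (fun x ↦ pCoeff lam x * deriv g x) (𝓝[{x | x ≠ lam ∧ x ≠ -lam}] a) (𝓝 c) →
      L ξ = c := by
    intro ξ g c hg hgd hgc
    rw [hL, hv₁, hv₂, inner_vectors_eq_m hab ξ hφ₂ hφ₂c hφ₂s]
    exact (limit_pCoeff_mul_deriv_eq hab hpJ hJU ξ hφ₂ hφ₂c hφ₂s hφ₂i hg hgd hgc).symm
  refine ⟨L, ?_, ⟨‖v₁‖ + ‖v₂‖, fun ξ ↦ ?_⟩, fun ξ hξ ↦ ?_, hbv⟩
  · -- `L ≠ 0`: the witness `χ log|x − a|`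
    obtain ⟨u₀, hu₀, hmem, hdiff, htends⟩ := exists_boundary_witness (lam := lam) ha'
    intro hL0
    have h := hbv ⟨hu₀.toLp u₀, hmem⟩ u₀ _ hu₀.coeFn_toLp hdiff htends
    rw [hL0, LinearMap.zero_apply] at h
    have h' : ((-(2 * a) : ℝ) : ℂ) = 0 := h.symm
    rw [Complex.ofReal_eq_zero] at h'
    exact ha0 (by linarith)
  · -- continuity in the graph norm (Cauchy–Schwarz)
    rw [hL]
    calc ‖⟪v₁, (ξ : L2R)⟫_ℂ + ⟪v₂, (prolateMax lam ξ : L2R)⟫_ℂ‖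
        ≤ ‖⟪v₁, (ξ : L2R)⟫_ℂ‖ + ‖⟪v₂, (prolateMax lam ξ : L2R)⟫_ℂ‖ := norm_add_le _ _
      _ ≤ ‖v₁‖ * ‖(ξ : L2R)‖ + ‖v₂‖ * ‖(prolateMax lam ξ : L2R)‖ :=
          add_le_add (norm_inner_le_norm _ _) (norm_inner_le_norm _ _)
      _ ≤ (‖v₁‖ + ‖v₂‖) * (‖(ξ : L2R)‖ + ‖prolateMax lam ξ‖) := by
          nlinarith [norm_nonneg v₁, norm_nonneg v₂, norm_nonneg (ξ : L2R),
            norm_nonneg (prolateMax lam ξ : L2R)]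
  · -- vanishing on `dom W_min`
    rw [hL, hv₁, hv₂]
    exact inner_vectors_eq_zero_of_mem_prolateMin hab hpa hφ₂ hφ₂c hφ₂s ξ hξ

end Assembly

end Literature.NumberTheory.ConnesMoscovici2022
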